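import Mathlib
import Literature.MathematicalPhysics.QuantumFieldTheory.MagnenRivasseauSeneor1993.MRS93LargeFieldFunctionals
import HarnessLib

/-!
# Magnen–Rivasseau–Sénéor, *Construction of YM₄ with an infrared cutoff* (CMP 155, 1993), §II.B (II.29b) p.337 —
# the large-field functional `H_Δ` OF THE CUT-OFF FIELD IN POSITION SPACE: the background field `B(Δ, x)` of (II.29c)
# as a field on Λ, its gradient `∇B(Δ, x)` as an HONEST derivative, `H_Δ(A) = (1/|Δ|)∫_Δ((λ_i^t)^{1−ε₁/64}M^{−2i}
# |∇B(Δ, x)|)^{P_{1,i}} d⁴x` as a measurable (indeed continuous) functional of the configuration, and (II.35) with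
# BOTH printed box functionals `E_Δ` (II.26) and `H_Δ` (II.29b)

statement-level bookkeeping of a published definition with citation tags; differentiability/measurability/continuity
PROVED; nothing here is a claim about the Yang–Mills mass gap, about continuum Yang–Mills on `T⁴` without infrared
cutoff, or about the Clay problem — and nothing of Magnen–Rivasseau–Sénéor's expansions or estimates is asserted or
formalised

**Citation header (reproduction of PUBLISHED work).** J. Magnen, V. Rivasseau, R. Sénéor, *Construction of YM₄ with an
infrared cutoff*, Commun. Math. Phys. **155** (1993) 325–383 [MagnenRivasseauSeneor1993], Sect. II.B p.337. Loci
`p.NNN tl.nn` = journal page and text-layer line of the held scan `paper:magnen1993-cmp155-mrs-ym4-infrared-cutoff`;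
(II.29a)–(II.31) were read on the 2× page-image crops `p13_crop_r1500-2700_s2.png` / `p13_crop_r2600-3700_s2.png`
(cell folder `run/shared/lean/pub/pub-balaban-gaps/pub-balaban-gaps-mrs-lit-1/g18/`, rendered from the Project-Euclid
scan with `renders-cmp155/tools/render.py`). Cell pub-balaban-gaps (YM blitz, track G3), seat mrs-lit-1 (statement
layer), gen 18; companion record `run/shared/lean/pub/pub-balaban-gaps/g3/MRS-AS-PRINTED.md`. Sibling modules used BY
NAME, nothing re-typed: `…MRS93LargeFieldFunctionals` (this seat, gen 17: `toPos`, `backgroundField`, `backgroundPos`,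
`Eprinted`, `lamT`, (II.35) with the printed `E_Δ`), `…MRS93LargeFieldRegions` (gen 17: `BoxLabel`, `Hbox`, `chiLFR`,
`Bprinted`/`Bprinted_eq`, `TestsPrinted`/`TestsGap`, `kIndex_pos`), `…MRS93PositionSpaceFields` (gen 9: `Pos`, `field`,
`chi`, `HasPartialAt`, `pderiv`, `hasPartialAt_chi`, `IsRealOn`, `conj_pderiv_field`), `…MRS93PhaseCells` (gen 0:
`largeGradH`, `kIndex`, `IsAdmissibleP1`), `…MRS93AnisotropicSlicing` (gen 2: `backgroundCutoff` (II.22), `indexFinset`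
= 𝐏), `…MRS93AxialYMAction` (`coeff`, `ymFactor`), `…MRS93GaussianReferenceMeasures` (`muZero`, `Momentum.neg`).

**What the paper prints (verbatim, page image p.337).** tl.7–10: *«We need further to know in each box of 𝐃 whether the
sum of the gradient of the fields of lower frequencies localized in the box is large or small. To gain a small factor
we need to create a gap between the scale of the box and the frequencies tested. In every box of 𝐃 we write:
1 = τ(H_Δ) − ∫₀¹ ds H_Δ τ′((1 − s)H_Δ), (II.29a) where τ is our reference C₀^∞ function and
H_Δ = (1/Δ) ∫_Δ ((λ_i^t)^{1−(ε₁/64)} M^{−2i} ∇B(Δ, x))^{P_{1,i}}, (II.29b) where P_{1,i} is an even integer close to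
(λ_i^t)^{−ε₁/32}, B(Δ, x) = Σ_{Δ′∈D_{i′,α′}, r(Δ)>r(Δ′)−k(Δ)} χ_{Δ′}(x) κ̃_{i′,α′} ∗ A (II.29c) with r(Δ) = (3i + α)/4,
and if Δ ∈ 𝐃_{i,α}: M^{k(Δ)} = (λ_i^t)^{−ε₁/16}. (II.30)»*; (II.22) p.335 tl.7–11 *«κ_j(p) = Σ_{j′<j} κ^{j′}(p), (II.22)
and the frequencies appearing in (II.22) are called the low or background frequencies (relative to the pair j)»*;
(II.35) p.339 tl.11–14 (quoted in `…MRS93LargeFieldRegions`).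

**What is typed here (0 `sorry`, 0 new named facts; every theorem kernel-checked).** `…MRS93PhaseCells` typed (II.29b)
over an ABSTRACT «∇B», `…MRS93LargeFieldRegions`/`…MRS93LargeFieldFunctionals` kept `H_Δ` an abstract measurable box
functional (the print raises the derivative MULTIPLET `∇B` to the power `P_{1,i}` without naming a scalar). This leaf
supplies the PRINTED `H_Δ` of the cut-off field, under the declared readings below:
* §1 **`bgConfig par N ρ₁ J A`** — the collapsed (II.29c) background field of the box in MOMENTUM space: the sum over the
  admissible slice pairs `j′ = (i′, α′) ∈ J` (explicit data; the printed set is §5's `admPrinted`) of the background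
  blocks `κ_{j′}(|p|,|p₀|)Ã(p)` (gen 17's `backgroundField`, (II.22)); `coeff_bgConfig` (`= κ_J(p)·Ã(p)` with
  `bgMultiplier` `κ_J = Σ_{j′∈J} κ_{j′}`); **`Bpos`** `= B(Δ, x)` ON Λ (Fourier synthesis), **`Bpos_eq_sum_backgroundPos`**
  (`B(Δ, x) = Σ_{j′∈J} (κ̃_{j′} ∗ A)(x)`), **`Bprinted_apply_eq_Bpos`**: gen 17's LITERAL (II.29c) `Bprinted` (with its
  characteristic functions `χ_{Δ′}(x)`) evaluated on the cut-off field IS `Bpos` with `J` = the printed admissible set —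
  no characteristic function survives the lattice-by-lattice collapse, so `B(Δ, ·)` is a trigonometric polynomial.
* §2 **`∇B` AS AN HONEST DERIVATIVE**: `derivConfig ν` (multiplication of the Fourier coefficients by `ip_ν`, on the real
  coordinates: `(Re, Im) ↦ (−p_ν Im, p_ν Re)`; `coeff_derivConfig`), **`hasPartialAt_field_derivConfig`** (`∂_ν` of ANY
  cut-off field = the field synthesised from `ip_νÃ(p)` — the content of «∂_μ ↔ ip_μ», from gen 9's `hasPartialAt_chi`),
  **`gradB par N S ρ₁ J A ν μ a x := ∂_ν B^a_μ(Δ, x)`** DEFINED as gen 9's `pderiv` and **`gradB_eq`**/**`gradB_eq_sum`**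
  (`∂_νB^a_μ(Δ,x) = Σ_{p∈S} ip_ν κ_J(p) Ã^a_μ(p) e^{ip·x}`, PROVED, not postulated); `hasDerivAt_Bpos_unitCoords` (READING (D)
  made explicit: along the period-`1` coordinate `y_ν` of `Λ = ℝ⁴/ℤ⁴` the derivative of `B(Δ, toPos y)` is `2π·∇_νB`);
  §2b reality: `isRealOn_bgConfig`, **`conj_gradB`** (`∇B` of a real cut-off field is real), `gradB_zero_config`.
* §3 READING (N′): **`gradBNorm`** `= |∇B(Δ, x)| := (½ Σ_ν Σ_μ Σ_a |∂_νB^a_μ(Δ, x)|²)^{1/2}` — the pointwise norm of the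
  derivative multiplet in the printed scalar product (the convention of gen 17's READING (N) for `E_Δ` and of gen 9's
  «(γ^i)^N»); nonnegativity, joint continuity in `(A, x)`, `gradBNorm_eq_zero_iff`; **`hPrinted`** = the datum
  `gradB A Δ : ℝ⁴ → ℝ` that `LargeFieldRegion.Hbox` takes, for the cut-off field (`hPrinted_add_intCast`: ℤ⁴-periodic).
* §4 **`Hprinted par N S M ε₁ lamT P₁ ρ₁ J Δ A`** `= H_Δ(A) = |Δ|⁻¹∫_Δ((λ_i^t)^{1−ε₁/64}M^{−2i}|∇B(Δ, y)|)^{P_{1,i}} dy` — (II.29b)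
  OF THE CUT-OFF CONFIGURATION (`Hprinted_eq`: literally, by `rfl`); `Hprinted_nonneg` (admissible = even `P_{1,i}`) /
  `Hprinted_nonneg'` (any power, nonnegative prefactor); **`measurable_Hprinted`** (Fubini); §4a′ **`Hprinted_corner_add`**
  (a functional of the box ON THE TORUS); §4b **`continuous_Hprinted`** (dominated convergence against the finite-mode
  majorant `gradMajorant`, `gradBNorm_le`); `Hprinted_zero_config` (`H_Δ(0) = 0`, so at `A = 0` only outcomes with
  `𝐃₂ = ∅` carry weight: `chiLFR_printedEH_zero_config`); §4c **`Hprinted_smul`**: `H_Δ(cA) = |c|^{P_{1,i}} H_Δ(A)` (`∇B` linear in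
  the field, `gradB_smul`; `H_Δ` a `P_{1,i}`-th power average of a seminorm of the configuration).
* §5 THE PRINTED INDEX SET of (II.29c) and (II.30): `kBox M ε₁ lamT Δ = k(Δ)` (`PhaseCells.kIndex` at `λ_i^t`, `kBox_pos`,
  `rpow_kBox` = (II.30) as printed), **`admPrinted kΔ Jset Δ`** (`r(Δ) > r(i′,α′) − k(Δ)`, AS PRINTED) and `admGap`
  (`r(Δ) > r(i′,α′) + k(Δ)`, the «gap» sentence tl.9–10) — precision (ab) of `…MRS93LargeFieldRegions`, both typed,
  `admGap_subset_admPrinted`, `mem_admPrinted_iff_testsPrinted`; **`JPrinted`** = the printed datum `Δ ↦ admPrinted k(Δ) 𝐏 Δ`;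
  **`hasDerivAt_Bprinted_unitCoords`**: the LITERAL (II.29c) — characteristic functions and all — is differentiable along every
  coordinate of `Λ = ℝ⁴/ℤ⁴` with derivative `2π·∇_νB` (no jump survives the lattice-by-lattice collapse).
* §6 **`lintegral_ymFactor_muZero_eq_sum_LFR_printedEH`**: (II.35) for the tree's `dμ_{0,ρ₁}`·`e^{(1/2)(…)}` with `E_Δ` =
  (II.26) AND `H_Δ` = (II.29b) THE PRINTED FUNCTIONALS of the cut-off field, in `[0, ∞]`, unconditionally (no binder
  left on `H_Δ`); Bochner form under the explicit integrability binder; weighted form for the other factors of (II.78);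
  `chiLFR_printedEH_mem_Icc`, `continuous_chiLFR_printedEH`, `measurable_chiLFR_printedEH`.
* §7 every printed symbol from the pinned carrier's `Parameters`: `indexPairs N ρ₁` (𝐏 with `ℤ` time labels),
  **`HprintedPar`** (`M = par.M`, `ε₁ = par.ε₁`, `λ_i^t = lamT par`, `κ_{j′}` from `par.τ, par.η, par.M`, `k(Δ)` from (II.30),
  admissible pairs AS PRINTED), `HprintedPar_nonneg`, `continuous_HprintedPar`, `measurable_HprintedPar`, `HprintedPar_zero_config`,
  **`lintegral_ymFactor_muZero_eq_sum_LFR_parEH`** ((II.35) with `τ, M, ε₁, λ_i^t, κ, k(Δ), dμ_{0,ρ₁}` and the exponential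
  all from `par`; `P_i`, `P_{1,i}`, `N_i`, `ρ₁` and the box set explicit data).

**Readings (declared).** (N′) the scalar of (II.29b) = the pointwise norm `|∇B(Δ, x)|` of the derivative multiplet in
the printed scalar product (p.328 tl.37–41) — the print raises `∇B` to `P_{1,i}` without naming a scalar; a
component-wise reading is another instance of `LargeFieldRegion.Hbox`. (D) `∇` = the `∂_μ` of (II.1) AS TYPED in
`…MRS93PositionSpaceFields` (READING (P′) there: the flat torus of period `2π` on which the tree's integer momenta are
the symbols of `−i∂_μ`), evaluated at the point with period-`1` coordinates `y`; along `y_ν` itself the derivative is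
`2π·∇_ν` (`hasDerivAt_Bpos_unitCoords`) — a convention the print («Λ* ≈ ℤ⁴», p.328 tl.12) leaves open. (ι), (κ),
(π), (τ) of `…MRS93LargeFieldFunctionals` inherited (`Int.toNat` time labels, `λ_i^t = √(tentativeCoupling)`, powers
as naturals, box averages against Lebesgue measure in period-`1` coordinates). (J) the admissible pairs of (II.29c) are
explicit data `J Δ`; the AS-PRINTED set `admPrinted` and the «gap» set `admGap` are both supplied (precision (ab) of
`…MRS93LargeFieldRegions`, recorded, not adjudicated).

**What is NOT claimed or typed.** Which outcome `(𝐃₁, 𝐃₂)` the expansion selects (the cluster/Mayer expansion of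
Sects. IV–VI); the small factor «attached to» the error-term boxes (p.337 tl.30–36, Lemma II.1 — mrs-lit-2's layer);
the geometric «intersect» of the corridors beyond `BoxLabel.Meets`; anything of Sects. III–VIII; anything of
Bałaban's. MRS work at FIXED INFRARED CUTOFF (p.328 tl.4–5): nothing here bears on infinite volume or a mass gap.
-/

noncomputable section

open MeasureTheory Set Real Finset Complex
open scoped ENNReal ComplexConjugate

namespace Literature.MathematicalPhysics.QuantumFieldTheory.MagnenRivasseauSeneor1993

namespace LargeFieldRegion

open Ansatz MainStatement PositionSpace

variable (par : Parameters) (N : ℕ → ℕ) (S : Finset Momentum)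

/-! ## §1 The collapsed (II.29c) background field `B(Δ, ·)` of the cut-off configuration, in momentum space and on Λ -/

/-- `κ_J(p) := Σ_{j′∈J} κ_{j′}(|p|, |p₀|)` — the total background multiplier of a finite set `J` of slice pairs
`j′ = (i′, α′)` (time label `α′ ∈ ℤ` read through `Int.toNat`, READING (ι)), `κ_{j′}` = (II.22) (`Ansatz.backgroundCutoff`).
[cite: MagnenRivasseauSeneor1993, (II.22) p.335 tl.7–11, (II.29c) p.337 tl.18–21] -/
def bgMultiplier (ρ₁ : ℕ) (J : Finset (ℕ × ℤ)) (p : Momentum) : ℝ :=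
  ∑ j' ∈ J, backgroundCutoff par.τ par.η par.M N ρ₁ (j'.1, j'.2.toNat) p.norm p.timeAbs

/-- **`B(Δ, ·)` IN MOMENTUM SPACE**: the sum over the admissible pairs `j′ ∈ J` of the background blocks `κ̃_{j′} ∗ A` of
the cut-off configuration (gen 17's `backgroundField`) — the collapsed form of (II.29c) (`Bprinted_eq`: the
characteristic functions `χ_{Δ′}(x)` sum to `1` lattice by lattice). [cite: MagnenRivasseauSeneor1993, (II.29c) p.337 tl.18–21 with (II.22) p.335] -/
def bgConfig (ρ₁ : ℕ) (J : Finset (ℕ × ℤ)) (A : Config) : Config := fun m =>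
  ∑ j' ∈ J, backgroundField par N ρ₁ (j'.1, j'.2.toNat) A m

/-- Mode-wise: `B(Δ)~(p) = κ_J(p) Ã(p)` on every real coordinate. [cite: MagnenRivasseauSeneor1993, (II.29c) p.337, (II.22) p.335] -/
theorem bgConfig_apply (ρ₁ : ℕ) (J : Finset (ℕ × ℤ)) (A : Config) (m : Mode) :
    bgConfig par N ρ₁ J A m = bgMultiplier par N ρ₁ J m.1 * A m := by
  unfold bgConfig bgMultiplier backgroundField
  rw [Finset.sum_mul]

/-- The Fourier coefficient of a mode-wise finite sum of configurations is the sum of the coefficients.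
[cite: MagnenRivasseauSeneor1993, §II.A p.328 tl.12–17] -/
theorem coeff_finset_sum {ι : Type*} (J : Finset ι) (F : ι → Config) (p : Momentum) (μ : Fin 4) (a : Fin 3) :
    coeff (fun m => ∑ j ∈ J, F j m) p μ a = ∑ j ∈ J, coeff (F j) p μ a := by
  unfold coeff
  push_cast
  rw [Finset.sum_add_distrib, Finset.sum_mul]

/-- The synthesised field of a mode-wise finite sum is the sum of the synthesised fields (Fourier synthesis is linear).
[cite: MagnenRivasseauSeneor1993, §II.A p.328 tl.12–17] -/
theorem field_finset_sum {ι : Type*} (J : Finset ι) (F : ι → Config) (μ : Fin 4) (a : Fin 3) (x : Pos) :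
    field S (fun m => ∑ j ∈ J, F j m) μ a x = ∑ j ∈ J, field S (F j) μ a x := by
  unfold field
  simp_rw [coeff_finset_sum, Finset.sum_mul]
  rw [Finset.sum_comm]

/-- `B(Δ)~^a_μ(p) = κ_J(p) · Ã^a_μ(p)`. [cite: MagnenRivasseauSeneor1993, (II.29c) p.337, (II.22) p.335] -/
theorem coeff_bgConfig (ρ₁ : ℕ) (J : Finset (ℕ × ℤ)) (A : Config) (p : Momentum) (μ : Fin 4) (a : Fin 3) :
    coeff (bgConfig par N ρ₁ J A) p μ a = (bgMultiplier par N ρ₁ J p : ℂ) * coeff A p μ a := by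
  unfold coeff
  rw [bgConfig_apply, bgConfig_apply]
  push_cast
  ring

/-- `A ↦ B(Δ)~` is continuous (mode-wise multiplication by `κ_J`). [cite: MagnenRivasseauSeneor1993, (II.29c) p.337] -/
theorem continuous_bgConfig (ρ₁ : ℕ) (J : Finset (ℕ × ℤ)) : Continuous (bgConfig par N ρ₁ J) := by
  refine continuous_pi fun m => ?_
  simp_rw [bgConfig_apply]
  exact continuous_const.mul (continuous_apply m)

/-- The background of the zero configuration vanishes. [cite: MagnenRivasseauSeneor1993, (II.29c) p.337] -/
theorem bgConfig_zero (ρ₁ : ℕ) (J : Finset (ℕ × ℤ)) : bgConfig par N ρ₁ J 0 = 0 := by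
  funext m
  rw [bgConfig_apply]
  simp

/-- **`B^a_μ(Δ, x)`** — the background field of the box ON Λ: the Fourier synthesis (`PositionSpace.field`) of
`bgConfig`, `= Σ_{p∈S} κ_J(p) Ã^a_μ(p) e^{ip·x}`. [cite: MagnenRivasseauSeneor1993, (II.29c) p.337 tl.18–21] -/
def Bpos (ρ₁ : ℕ) (J : Finset (ℕ × ℤ)) (A : Config) (μ : Fin 4) (a : Fin 3) (x : Pos) : ℂ :=
  field S (bgConfig par N ρ₁ J A) μ a x

/-- **`B(Δ, x) = Σ_{j′∈J} (κ̃_{j′} ∗ A)(x)`** — the finite sum of gen 17's position-space background fields over the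
admissible pairs. [cite: MagnenRivasseauSeneor1993, (II.29c) p.337 tl.18–21] -/
theorem Bpos_eq_sum_backgroundPos (ρ₁ : ℕ) (J : Finset (ℕ × ℤ)) (A : Config) (μ : Fin 4) (a : Fin 3) (x : Pos) :
    Bpos par N S ρ₁ J A μ a x = ∑ j' ∈ J, backgroundPos par N S ρ₁ (j'.1, j'.2.toNat) A x μ a := by
  unfold Bpos bgConfig backgroundPos
  exact field_finset_sum S J _ μ a x

/-- **THE LITERAL (II.29c) OF THE CUT-OFF FIELD IS `Bpos`**: gen 17's `Bprinted` — `Σ_{Δ′ ∈ 𝐃_{i′,α′}, r(Δ)>r(Δ′)−k(Δ)}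
χ_{Δ′}(x) κ̃_{i′,α′} ∗ A` with its characteristic functions — evaluated on the background multiplets of the cut-off
configuration equals `B(Δ, x)` with `J` = the pairs of `Jset` passing the PRINTED index test (`M > 0`; §5's
`admPrinted`). [cite: MagnenRivasseauSeneor1993, (II.29c) p.337 tl.18–21] -/
theorem Bprinted_apply_eq_Bpos {M : ℝ} (hM : 0 < M) (kΔ : ℝ) (ρ₁ : ℕ) (Jset : Finset (ℕ × ℤ)) (A : Config)
    (Δ : BoxLabel) (y : Fin 4 → ℝ) (μ : Fin 4) (a : Fin 3) :
    Bprinted M kΔ Jset (fun j' y' => backgroundPos par N S ρ₁ (j'.1, j'.2.toNat) A (toPos y')) Δ y μ a =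
      Bpos par N S ρ₁ (Jset.filter fun j' => PhaseCells.rIndex j'.1 j'.2 - kΔ < Δ.r) A μ a (toPos y) := by
  rw [Bprinted_eq hM, Finset.sum_apply, Finset.sum_apply, Bpos_eq_sum_backgroundPos]

/-- `x ↦ B^a_μ(Δ, x)` is continuous (a trigonometric polynomial). [cite: MagnenRivasseauSeneor1993, (II.29c) p.337] -/
theorem continuous_Bpos (ρ₁ : ℕ) (J : Finset (ℕ × ℤ)) (A : Config) (μ : Fin 4) (a : Fin 3) :
    Continuous (Bpos par N S ρ₁ J A μ a) :=
  continuous_field S _ μ a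

/-! ## §2 `∇B(Δ, x)` AS AN HONEST DERIVATIVE: `∂_ν ↔ ip_ν` on the cut-off configuration -/

/-- **Multiplication by `ip_ν` on configurations**: on the real coordinates `(Re Ã^a_μ(p), Im Ã^a_μ(p))` of a mode the
map `(u, v) ↦ (−p_ν v, p_ν u)` — so that `(∂_νA)~(p) = ip_ν Ã(p)` («∂_μ ↔ ip_μ», the momenta being «discrete Fourier
analysis on the dual lattice», p.328 tl.12). [cite: MagnenRivasseauSeneor1993, (II.1) p.328 tl.28–30, §II.A p.328 tl.12–17] -/
def derivConfig (ν : Fin 4) (A : Config) : Config := fun m =>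
  bif m.2.2.2 then ((m.1.1 ν : ℤ) : ℝ) * A (m.1, m.2.1, m.2.2.1, false)
  else -(((m.1.1 ν : ℤ) : ℝ) * A (m.1, m.2.1, m.2.2.1, true))

/-- `(∂_νA)~^a_μ(p) = ip_ν Ã^a_μ(p)`. [cite: MagnenRivasseauSeneor1993, (II.1) p.328 tl.28–30] -/
theorem coeff_derivConfig (ν : Fin 4) (A : Config) (p : Momentum) (μ : Fin 4) (a : Fin 3) :
    coeff (derivConfig ν A) p μ a = I * ((p.1 ν : ℤ) : ℂ) * coeff A p μ a := by
  have h1 : derivConfig ν A (p, μ, a, false) = -(((p.1 ν : ℤ) : ℝ) * A (p, μ, a, true)) := rfl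
  have h2 : derivConfig ν A (p, μ, a, true) = ((p.1 ν : ℤ) : ℝ) * A (p, μ, a, false) := rfl
  unfold coeff
  rw [h1, h2]
  push_cast
  ring_nf
  rw [I_sq]
  ring

/-- `derivConfig ν` is continuous (each coordinate is `±p_ν` times another coordinate). [cite: MagnenRivasseauSeneor1993, (II.1) p.328] -/
theorem continuous_derivConfig (ν : Fin 4) : Continuous (derivConfig ν : Config → Config) := by
  refine continuous_pi fun m => ?_
  obtain ⟨p, μ, a, b⟩ := m
  cases b
  · exact ((continuous_const.mul (continuous_apply _)).neg :
      Continuous fun A : Config => -(((p.1 ν : ℤ) : ℝ) * A (p, μ, a, true)))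
  · exact (continuous_const.mul (continuous_apply _) :
      Continuous fun A : Config => ((p.1 ν : ℤ) : ℝ) * A (p, μ, a, false))

/-- `derivConfig ν 0 = 0`. [cite: MagnenRivasseauSeneor1993, (II.1) p.328] -/
theorem derivConfig_zero (ν : Fin 4) : derivConfig ν (0 : Config) = 0 := by
  funext m
  obtain ⟨p, μ, a, b⟩ := m
  cases b
  · show -(((p.1 ν : ℤ) : ℝ) * (0 : Config) (p, μ, a, true)) = 0
    simp
  · show ((p.1 ν : ℤ) : ℝ) * (0 : Config) (p, μ, a, false) = 0
    simp

/-- **`∂_ν A^a_μ(x) = Σ_{p∈S} ip_ν Ã^a_μ(p) e^{ip·x}` = the field synthesised from `derivConfig ν A`**, as an HONEST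
derivative along the coordinate circle `ν` (from gen 9's `hasPartialAt_chi`: `∂_ν e^{ip·x} = ip_ν e^{ip·x}`), for every
cut-off configuration. [cite: MagnenRivasseauSeneor1993, (II.1) p.328 tl.28–30, §II.A p.328 tl.12–17] -/
theorem hasPartialAt_field_derivConfig (A : Config) (μ : Fin 4) (a : Fin 3) (ν : Fin 4) (x : Pos) :
    HasPartialAt ν (field S A μ a) (field S (derivConfig ν A) μ a x) x := by
  unfold HasPartialAt field
  refine (HasDerivAt.fun_sum (u := S) fun p _ => (hasPartialAt_chi p.1 ν x).const_mul (coeff A p μ a)).congr_deriv ?_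
  refine Finset.sum_congr rfl fun p _ => ?_
  rw [coeff_derivConfig]
  ring

/-- … the same for `pderiv`: `∂_ν A^a_μ(x) = (field of derivConfig ν A)^a_μ(x)`. [cite: MagnenRivasseauSeneor1993, (II.1) p.328 tl.28–30] -/
theorem pderiv_field_eq_field_derivConfig (A : Config) (μ : Fin 4) (a : Fin 3) (ν : Fin 4) (x : Pos) :
    pderiv ν (field S A μ a) x = field S (derivConfig ν A) μ a x :=
  (hasPartialAt_field_derivConfig S A μ a ν x).pderiv_eq

/-- **`∇B(Δ, x)`: `gradB … ν μ a x := ∂_ν B^a_μ(Δ, x)`** — DEFINED as the honest partial derivative (gen 9's `pderiv`,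
READING (D)) of the background field of the box; «the sum of the gradient of the fields of lower frequencies localized
in the box» (p.337 tl.7–8). [cite: MagnenRivasseauSeneor1993, (II.29b)–(II.29c) p.337 tl.7–8, tl.15–21] -/
def gradB (ρ₁ : ℕ) (J : Finset (ℕ × ℤ)) (A : Config) (ν μ : Fin 4) (a : Fin 3) (x : Pos) : ℂ :=
  pderiv ν (Bpos par N S ρ₁ J A μ a) x

/-- `B(Δ, ·)` HAS the partial derivative `∇_νB` at every point. [cite: MagnenRivasseauSeneor1993, (II.29b) p.337] -/
theorem hasPartialAt_Bpos (ρ₁ : ℕ) (J : Finset (ℕ × ℤ)) (A : Config) (ν μ : Fin 4) (a : Fin 3) (x : Pos) :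
    HasPartialAt ν (Bpos par N S ρ₁ J A μ a) (field S (derivConfig ν (bgConfig par N ρ₁ J A)) μ a x) x :=
  hasPartialAt_field_derivConfig S _ μ a ν x

/-- **`∇_νB^a_μ(Δ, x)` = the field synthesised from `ip_ν B(Δ)~(p)`** (PROVED from the definition as a derivative).
[cite: MagnenRivasseauSeneor1993, (II.29b) p.337 tl.15–17] -/
theorem gradB_eq (ρ₁ : ℕ) (J : Finset (ℕ × ℤ)) (A : Config) (ν μ : Fin 4) (a : Fin 3) (x : Pos) :
    gradB par N S ρ₁ J A ν μ a x = field S (derivConfig ν (bgConfig par N ρ₁ J A)) μ a x :=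
  (hasPartialAt_Bpos par N S ρ₁ J A ν μ a x).pderiv_eq

/-- **`∇_νB^a_μ(Δ, x) = Σ_{p∈S} ip_ν κ_J(p) Ã^a_μ(p) e^{ip·x}`**, explicitly. [cite: MagnenRivasseauSeneor1993, (II.29b)–(II.29c) p.337, (II.22) p.335] -/
theorem gradB_eq_sum (ρ₁ : ℕ) (J : Finset (ℕ × ℤ)) (A : Config) (ν μ : Fin 4) (a : Fin 3) (x : Pos) :
    gradB par N S ρ₁ J A ν μ a x =
      ∑ p ∈ S, I * ((p.1 ν : ℤ) : ℂ) * (bgMultiplier par N ρ₁ J p : ℂ) * coeff A p μ a * chi p.1 x := by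
  rw [gradB_eq]
  unfold field
  refine Finset.sum_congr rfl fun p _ => ?_
  rw [coeff_derivConfig, coeff_bgConfig]
  ring

/-- `x ↦ ∇_νB^a_μ(Δ, x)` is continuous. [cite: MagnenRivasseauSeneor1993, (II.29b) p.337] -/
theorem continuous_gradB (ρ₁ : ℕ) (J : Finset (ℕ × ℤ)) (A : Config) (ν μ : Fin 4) (a : Fin 3) :
    Continuous (gradB par N S ρ₁ J A ν μ a) := by
  rw [show gradB par N S ρ₁ J A ν μ a = field S (derivConfig ν (bgConfig par N ρ₁ J A)) μ a from
    funext fun x => gradB_eq par N S ρ₁ J A ν μ a x]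
  exact continuous_field S _ μ a

/-- `(A, x) ↦ ∇_νB^a_μ(Δ, x)` is JOINTLY continuous (finitely many coordinates of `A` times characters).
[cite: MagnenRivasseauSeneor1993, (II.29b) p.337] -/
theorem continuous_gradB_uncurry (ρ₁ : ℕ) (J : Finset (ℕ × ℤ)) (ν μ : Fin 4) (a : Fin 3) :
    Continuous fun Ax : Config × Pos => gradB par N S ρ₁ J Ax.1 ν μ a Ax.2 := by
  simp_rw [gradB_eq]
  unfold field
  refine continuous_finsetSum _ fun p _ => ?_
  exact ((continuous_coeff p μ a).comp ((continuous_derivConfig ν).comp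
    ((continuous_bgConfig par N ρ₁ J).comp continuous_fst))).mul ((continuous_chi p.1).comp continuous_snd)

/-- `∇B` of the zero configuration vanishes. [cite: MagnenRivasseauSeneor1993, (II.29b) p.337] -/
theorem gradB_zero_config (ρ₁ : ℕ) (J : Finset (ℕ × ℤ)) (ν μ : Fin 4) (a : Fin 3) (x : Pos) :
    gradB par N S ρ₁ J 0 ν μ a x = 0 := by
  rw [gradB_eq_sum]
  refine Finset.sum_eq_zero fun p _ => ?_
  simp [coeff]

/-- READING (D) MADE EXPLICIT. In period-`1` coordinates `y` of `Λ = ℝ⁴/ℤ⁴` (gen 17's `toPos`) a translation of `y_ν` by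
`s` is a translation of the period-`2π` coordinate by `2πs`. [cite: MagnenRivasseauSeneor1993, §II.A p.328 tl.8–13] -/
theorem toPos_add_single (y : Fin 4 → ℝ) (ν : Fin 4) (s : ℝ) :
    toPos (y + Pi.single ν s) = shift ν (2 * Real.pi * s) (toPos y) := by
  funext μ
  simp only [toPos, shift, Pi.add_apply]
  by_cases h : μ = ν
  · subst h
    rw [Pi.single_eq_same, Pi.single_eq_same, mul_add, AddCircle.coe_add]
  · rw [Pi.single_eq_of_ne h, Pi.single_eq_of_ne h, add_zero, add_zero]

/-- **READING (D), quantified**: along the period-`1` coordinate `y_ν` the derivative of `s ↦ B^a_μ(Δ, toPos(y + s e_ν))`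
at `s = 0` is `2π · ∇_νB^a_μ(Δ, toPos y)` — the tree's `∇` is the `∂_μ` of (II.1) in the period-`2π` model where the
integer momenta are the symbols of `−i∂_μ`; a reader using `d/dy_ν` on `ℝ⁴/ℤ⁴` rescales `∇B` by `2π`.
[cite: MagnenRivasseauSeneor1993, §II.A p.328 tl.8–13, (II.29b) p.337] -/
theorem hasDerivAt_Bpos_unitCoords (ρ₁ : ℕ) (J : Finset (ℕ × ℤ)) (A : Config) (ν μ : Fin 4) (a : Fin 3)
    (y : Fin 4 → ℝ) :
    HasDerivAt (fun s : ℝ => Bpos par N S ρ₁ J A μ a (toPos (y + Pi.single ν s)))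
      ((2 * Real.pi : ℝ) • gradB par N S ρ₁ J A ν μ a (toPos y)) 0 := by
  have h := hasPartialAt_Bpos par N S ρ₁ J A ν μ a (toPos y)
  unfold HasPartialAt at h
  -- compose with the linear reparametrisation `s ↦ 2π s`
  have hlin : HasDerivAt (fun s : ℝ => 2 * Real.pi * s) (2 * Real.pi) 0 := by
    simpa using (hasDerivAt_id (0 : ℝ)).const_mul (2 * Real.pi)
  have h0 : (2 * Real.pi * (0 : ℝ)) = 0 := by ring
  rw [← h0] at h
  have hc := HasDerivAt.scomp (0 : ℝ) h hlin
  simp_rw [Function.comp_def] at hc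
  rw [gradB_eq]
  refine (hc.congr_of_eventuallyEq (Filter.Eventually.of_forall fun s => ?_))
  simp only [toPos_add_single]

/-! ## §2b Reality: `∇B` of a real cut-off field is real -/

/-- The background multiplier is even in `p` (it depends on `|p|`, `|p₀|` only). [cite: MagnenRivasseauSeneor1993, (II.22) p.335] -/
theorem bgMultiplier_neg (ρ₁ : ℕ) (J : Finset (ℕ × ℤ)) (p : Momentum) :
    bgMultiplier par N ρ₁ J p.neg = bgMultiplier par N ρ₁ J p := by
  unfold bgMultiplier
  rw [Momentum.norm_neg, timeAbs_neg]

/-- `B(Δ)~` obeys the reality constraint `B̃(−p) = conj B̃(p)` when `Ã` does (real, even multiplier).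
[cite: MagnenRivasseauSeneor1993, (II.29c) p.337, §II.A p.328 tl.12–17] -/
theorem isRealOn_bgConfig {S : Finset Momentum} {A : Config} (hA : IsRealOn S A) (ρ₁ : ℕ) (J : Finset (ℕ × ℤ)) :
    IsRealOn S (bgConfig par N ρ₁ J A) := by
  intro p hp
  refine ⟨(hA p hp).1, fun μ a => ?_⟩
  rw [coeff_bgConfig, coeff_bgConfig, bgMultiplier_neg, (hA p hp).2 μ a, map_mul, Complex.conj_ofReal]

/-- **`B^a_μ(Δ, x) ∈ ℝ`** for a cut-off configuration obeying the reality constraint. [cite: MagnenRivasseauSeneor1993, (II.29c) p.337] -/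
theorem conj_Bpos {S : Finset Momentum} {A : Config} (hA : IsRealOn S A) (ρ₁ : ℕ) (J : Finset (ℕ × ℤ)) (μ : Fin 4)
    (a : Fin 3) (x : Pos) : conj (Bpos par N S ρ₁ J A μ a x) = Bpos par N S ρ₁ J A μ a x :=
  conj_field (isRealOn_bgConfig par N hA ρ₁ J) μ a x

/-- **`∇_νB^a_μ(Δ, x) ∈ ℝ`** for a cut-off configuration obeying the reality constraint (as `dμ_{0,ρ₁}`-a.e. configuration
does on a symmetric window, `PositionSpace.ae_isRealOn_muZero`). [cite: MagnenRivasseauSeneor1993, (II.29b) p.337, §II.A p.328 tl.12–17] -/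
theorem conj_gradB {S : Finset Momentum} {A : Config} (hA : IsRealOn S A) (ρ₁ : ℕ) (J : Finset (ℕ × ℤ)) (ν μ : Fin 4)
    (a : Fin 3) (x : Pos) : conj (gradB par N S ρ₁ J A ν μ a x) = gradB par N S ρ₁ J A ν μ a x :=
  conj_pderiv_field (isRealOn_bgConfig par N hA ρ₁ J) μ a ν x

/-- … i.e. its imaginary part vanishes. [cite: MagnenRivasseauSeneor1993, (II.29b) p.337] -/
theorem gradB_im {S : Finset Momentum} {A : Config} (hA : IsRealOn S A) (ρ₁ : ℕ) (J : Finset (ℕ × ℤ)) (ν μ : Fin 4)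
    (a : Fin 3) (x : Pos) : (gradB par N S ρ₁ J A ν μ a x).im = 0 :=
  Complex.conj_eq_iff_im.mp (conj_gradB par N hA ρ₁ J ν μ a x)

/-! ## §3 READING (N′): the scalar «∇B(Δ, x)» = the pointwise norm of the derivative multiplet -/

/-- `|∇B(Δ, x)|² := ½ Σ_ν Σ_μ Σ_a |∂_νB^a_μ(Δ, x)|²` — the pointwise squared norm of the derivative multiplet in the
printed scalar product (p.328 tl.37–41, the factor `1/2` of the component notation; READING (N′)).
[cite: MagnenRivasseauSeneor1993, (II.29b) p.337, §II.A p.328 tl.37–41] -/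
def gradBNormSq (ρ₁ : ℕ) (J : Finset (ℕ × ℤ)) (A : Config) (x : Pos) : ℝ :=
  (1 / 2) * ∑ ν, ∑ μ, ∑ a, normSq (gradB par N S ρ₁ J A ν μ a x)

/-- `|∇B(Δ, x)|`. [cite: MagnenRivasseauSeneor1993, (II.29b) p.337] -/
def gradBNorm (ρ₁ : ℕ) (J : Finset (ℕ × ℤ)) (A : Config) (x : Pos) : ℝ :=
  Real.sqrt (gradBNormSq par N S ρ₁ J A x)

/-- `0 ≤ |∇B(Δ, x)|²`. [cite: MagnenRivasseauSeneor1993, (II.29b) p.337] -/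
theorem gradBNormSq_nonneg (ρ₁ : ℕ) (J : Finset (ℕ × ℤ)) (A : Config) (x : Pos) :
    0 ≤ gradBNormSq par N S ρ₁ J A x :=
  mul_nonneg (by norm_num) (Finset.sum_nonneg fun _ _ => Finset.sum_nonneg fun _ _ =>
    Finset.sum_nonneg fun _ _ => normSq_nonneg _)

/-- `0 ≤ |∇B(Δ, x)|`. [cite: MagnenRivasseauSeneor1993, (II.29b) p.337] -/
theorem gradBNorm_nonneg (ρ₁ : ℕ) (J : Finset (ℕ × ℤ)) (A : Config) (x : Pos) : 0 ≤ gradBNorm par N S ρ₁ J A x :=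
  Real.sqrt_nonneg _

/-- `(A, x) ↦ |∇B(Δ, x)|²` is jointly continuous. [cite: MagnenRivasseauSeneor1993, (II.29b) p.337] -/
theorem continuous_gradBNormSq_uncurry (ρ₁ : ℕ) (J : Finset (ℕ × ℤ)) :
    Continuous fun Ax : Config × Pos => gradBNormSq par N S ρ₁ J Ax.1 Ax.2 := by
  unfold gradBNormSq
  refine continuous_const.mul (continuous_finsetSum _ fun ν _ => continuous_finsetSum _ fun μ _ =>
    continuous_finsetSum _ fun a _ => ?_)
  exact Complex.continuous_normSq.comp (continuous_gradB_uncurry par N S ρ₁ J ν μ a)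

/-- `(A, x) ↦ |∇B(Δ, x)|` is jointly continuous. [cite: MagnenRivasseauSeneor1993, (II.29b) p.337] -/
theorem continuous_gradBNorm_uncurry (ρ₁ : ℕ) (J : Finset (ℕ × ℤ)) :
    Continuous fun Ax : Config × Pos => gradBNorm par N S ρ₁ J Ax.1 Ax.2 :=
  Real.continuous_sqrt.comp (continuous_gradBNormSq_uncurry par N S ρ₁ J)

/-- `x ↦ |∇B(Δ, x)|` is continuous. [cite: MagnenRivasseauSeneor1993, (II.29b) p.337] -/
theorem continuous_gradBNorm (ρ₁ : ℕ) (J : Finset (ℕ × ℤ)) (A : Config) : Continuous (gradBNorm par N S ρ₁ J A) := by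
  have h := (continuous_gradBNorm_uncurry par N S ρ₁ J).comp (Continuous.prodMk_right A)
  exact h

/-- `|∇B(Δ, x)| = 0` exactly where every component `∂_νB^a_μ(Δ, x)` vanishes. [cite: MagnenRivasseauSeneor1993, (II.29b) p.337] -/
theorem gradBNorm_eq_zero_iff (ρ₁ : ℕ) (J : Finset (ℕ × ℤ)) (A : Config) (x : Pos) :
    gradBNorm par N S ρ₁ J A x = 0 ↔ ∀ ν μ a, gradB par N S ρ₁ J A ν μ a x = 0 := by
  unfold gradBNorm gradBNormSq
  rw [Real.sqrt_eq_zero (mul_nonneg (by norm_num) (Finset.sum_nonneg fun _ _ => Finset.sum_nonneg fun _ _ =>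
    Finset.sum_nonneg fun _ _ => normSq_nonneg _))]
  rw [mul_eq_zero, or_iff_right (by norm_num : ¬(1 / 2 : ℝ) = 0)]
  rw [Finset.sum_eq_zero_iff_of_nonneg fun ν _ => Finset.sum_nonneg fun μ _ =>
    Finset.sum_nonneg fun a _ => normSq_nonneg _]
  simp only [Finset.mem_univ, forall_true_left]
  refine forall_congr' fun ν => ?_
  rw [Finset.sum_eq_zero_iff_of_nonneg fun μ _ => Finset.sum_nonneg fun a _ => normSq_nonneg _]
  simp only [Finset.mem_univ, forall_true_left]
  refine forall_congr' fun μ => ?_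
  rw [Finset.sum_eq_zero_iff_of_nonneg fun a _ => normSq_nonneg _]
  simp only [Finset.mem_univ, forall_true_left, Complex.normSq_eq_zero]

/-- For a real cut-off configuration `|∇B(Δ, x)|² = ½ Σ (Re ∂_νB^a_μ)²` — an honest sum of squares of REAL derivatives.
[cite: MagnenRivasseauSeneor1993, (II.29b) p.337, §II.A p.328 tl.37–41] -/
theorem gradBNormSq_eq_sum_re_sq {S : Finset Momentum} {A : Config} (hA : IsRealOn S A) (ρ₁ : ℕ)
    (J : Finset (ℕ × ℤ)) (x : Pos) :
    gradBNormSq par N S ρ₁ J A x = (1 / 2) * ∑ ν, ∑ μ, ∑ a, (gradB par N S ρ₁ J A ν μ a x).re ^ 2 := by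
  unfold gradBNormSq
  congr 1
  refine Finset.sum_congr rfl fun ν _ => Finset.sum_congr rfl fun μ _ => Finset.sum_congr rfl fun a _ => ?_
  rw [normSq_apply, gradB_im par N hA]
  ring

/-- `|∇B(Δ, x)|` of the zero configuration is `0`. [cite: MagnenRivasseauSeneor1993, (II.29b) p.337] -/
theorem gradBNorm_zero_config (ρ₁ : ℕ) (J : Finset (ℕ × ℤ)) (x : Pos) : gradBNorm par N S ρ₁ J 0 x = 0 :=
  (gradBNorm_eq_zero_iff par N S ρ₁ J 0 x).mpr fun ν μ a => gradB_zero_config par N S ρ₁ J ν μ a x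

/-- The datum `gradB` that `LargeFieldRegion.Hbox` takes, FOR THE CUT-OFF FIELD: `hPrinted … J A Δ y = |∇B(Δ, toPos y)|`
with `J Δ` the admissible slice pairs of the box (explicit data; the printed choice is §5's `JPrinted`), `y ∈ ℝ⁴` the
period-`1` coordinates of the point. [cite: MagnenRivasseauSeneor1993, (II.29b)–(II.29c) p.337] -/
def hPrinted (ρ₁ : ℕ) (J : BoxLabel → Finset (ℕ × ℤ)) (A : Config) (Δ : BoxLabel) (y : Fin 4 → ℝ) : ℝ :=
  gradBNorm par N S ρ₁ (J Δ) A (toPos y)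

/-- `(A, y) ↦ hPrinted A Δ y` is jointly continuous. [cite: MagnenRivasseauSeneor1993, (II.29b) p.337] -/
theorem continuous_hPrinted_uncurry (ρ₁ : ℕ) (J : BoxLabel → Finset (ℕ × ℤ)) (Δ : BoxLabel) :
    Continuous fun Ay : Config × (Fin 4 → ℝ) => hPrinted par N S ρ₁ J Ay.1 Δ Ay.2 := by
  change Continuous ((fun Ax : Config × Pos => gradBNorm par N S ρ₁ (J Δ) Ax.1 Ax.2) ∘
    fun Ay : Config × (Fin 4 → ℝ) => (Ay.1, toPos Ay.2))
  exact (continuous_gradBNorm_uncurry par N S ρ₁ (J Δ)).comp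
    (continuous_fst.prodMk (continuous_toPos.comp continuous_snd))

/-- `0 ≤ hPrinted`. [cite: MagnenRivasseauSeneor1993, (II.29b) p.337] -/
theorem hPrinted_nonneg (ρ₁ : ℕ) (J : BoxLabel → Finset (ℕ × ℤ)) (A : Config) (Δ : BoxLabel) (y : Fin 4 → ℝ) :
    0 ≤ hPrinted par N S ρ₁ J A Δ y :=
  gradBNorm_nonneg par N S ρ₁ _ A _

/-- `hPrinted` is `ℤ⁴`-periodic in `y` (a function on `Λ = ℝ⁴/ℤ⁴`). [cite: MagnenRivasseauSeneor1993, §II.A p.328 tl.8] -/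
theorem hPrinted_add_intCast (ρ₁ : ℕ) (J : BoxLabel → Finset (ℕ × ℤ)) (A : Config) (Δ : BoxLabel) (y : Fin 4 → ℝ)
    (n : Fin 4 → ℤ) : hPrinted par N S ρ₁ J A Δ (fun μ => y μ + n μ) = hPrinted par N S ρ₁ J A Δ y := by
  unfold hPrinted; rw [toPos_add_intCast]

/-- `hPrinted` of the zero configuration vanishes. [cite: MagnenRivasseauSeneor1993, (II.29b) p.337] -/
theorem hPrinted_zero_config (ρ₁ : ℕ) (J : BoxLabel → Finset (ℕ × ℤ)) (Δ : BoxLabel) (y : Fin 4 → ℝ) :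
    hPrinted par N S ρ₁ J 0 Δ y = 0 :=
  gradBNorm_zero_config par N S ρ₁ _ _

/-! ## §4 (II.29b) FOR THE CUT-OFF FIELD: `H_Δ(A)` as a functional of the configuration -/

/-- **`H_Δ(A) = (1/|Δ|) ∫_Δ ((λ_i^t)^{1−ε₁/64} M^{−2i} |∇B(Δ, x)|)^{P_{1,i}} d⁴x`** (II.29b) for the box `Δ = ((i, α), k)` of
`𝐃_{i,α}` and the cut-off field `A` on the window `S`: `LargeFieldRegion.Hbox` (= `PhaseCells.largeGradH` on the box) at the
gradient datum `hPrinted`. `lamT i` = `λ_i^t` (II.12), `P₁ i` = `P_{1,i}` read as a natural number («an even integer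
close to (λ_i^t)^{−ε₁/32}»: `PhaseCells.IsAdmissibleP1`, `PhaseCells.exponentP1Target`), `ρ₁` the index cutoff of 𝐏,
`J Δ` the admissible pairs of (II.29c). [cite: MagnenRivasseauSeneor1993, (II.29b) p.337 tl.15–18] -/
def Hprinted (M ε₁ : ℝ) (lamT : ℕ → ℝ) (P₁ : ℕ → ℕ) (ρ₁ : ℕ) (J : BoxLabel → Finset (ℕ × ℤ)) (Δ : BoxLabel)
    (A : Config) : ℝ :=
  Hbox M ε₁ lamT P₁ (hPrinted par N S ρ₁ J) Δ A

/-- (II.29b) unfolded, literally: `H_Δ(A) = |Δ|⁻¹ ∫_Δ ((λ_i^t)^{1−ε₁/64} M^{−2i} |∇B(Δ, y)|)^{P_{1,i}} dy`.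
[cite: MagnenRivasseauSeneor1993, (II.29b) p.337 tl.15–17] -/
theorem Hprinted_eq (M ε₁ : ℝ) (lamT : ℕ → ℝ) (P₁ : ℕ → ℕ) (ρ₁ : ℕ) (J : BoxLabel → Finset (ℕ × ℤ)) (Δ : BoxLabel)
    (A : Config) :
    Hprinted par N S M ε₁ lamT P₁ ρ₁ J Δ A =
      (volume (Δ.toSet M)).toReal⁻¹ *
        ∫ y in Δ.toSet M, (lamT Δ.1.1 ^ (1 - ε₁ / 64) * M ^ (-(2 * (Δ.1.1 : ℤ))) * hPrinted par N S ρ₁ J A Δ y) ^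
          P₁ Δ.1.1 :=
  rfl

/-- `H_Δ(A) ≥ 0` for admissible (even) `P_{1,i}`. [cite: MagnenRivasseauSeneor1993, (II.29b) p.337 tl.18] -/
theorem Hprinted_nonneg (M ε₁ : ℝ) (lamT : ℕ → ℝ) {P₁ : ℕ → ℕ} (hP₁ : ∀ i, PhaseCells.IsAdmissibleP1 (P₁ i)) (ρ₁ : ℕ)
    (J : BoxLabel → Finset (ℕ × ℤ)) (Δ : BoxLabel) (A : Config) : 0 ≤ Hprinted par N S M ε₁ lamT P₁ ρ₁ J Δ A :=
  Hbox_nonneg M ε₁ lamT hP₁ _ Δ A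

/-- `H_Δ(A) ≥ 0` for EVERY power when the prefactor is nonnegative (`λ_i^t ≥ 0`, `M ≥ 0`).
[cite: MagnenRivasseauSeneor1993, (II.29b) p.337] -/
theorem Hprinted_nonneg' {M : ℝ} (hM : 0 ≤ M) (ε₁ : ℝ) {lamT : ℕ → ℝ} (hlam : ∀ i, 0 ≤ lamT i) (P₁ : ℕ → ℕ) (ρ₁ : ℕ)
    (J : BoxLabel → Finset (ℕ × ℤ)) (Δ : BoxLabel) (A : Config) : 0 ≤ Hprinted par N S M ε₁ lamT P₁ ρ₁ J Δ A := by
  rw [Hprinted_eq]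
  refine mul_nonneg (inv_nonneg.mpr ENNReal.toReal_nonneg) (integral_nonneg fun y => pow_nonneg ?_ _)
  exact mul_nonneg (mul_nonneg (Real.rpow_nonneg (hlam _) _) (zpow_nonneg hM _)) (hPrinted_nonneg par N S ρ₁ J A _ y)

/-- The integrand of (II.29b), `(A, y) ↦ ((λ_i^t)^{1−ε₁/64} M^{−2i} |∇B(Δ, y)|)^{P_{1,i}}`, is jointly continuous.
[cite: MagnenRivasseauSeneor1993, (II.29b) p.337] -/
theorem continuous_integrandH_uncurry (M ε₁ : ℝ) (lamT : ℕ → ℝ) (P₁ : ℕ → ℕ) (ρ₁ : ℕ) (J : BoxLabel → Finset (ℕ × ℤ))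
    (Δ : BoxLabel) :
    Continuous fun Ay : Config × (Fin 4 → ℝ) =>
      (lamT Δ.1.1 ^ (1 - ε₁ / 64) * M ^ (-(2 * (Δ.1.1 : ℤ))) * hPrinted par N S ρ₁ J Ay.1 Δ Ay.2) ^ P₁ Δ.1.1 :=
  (continuous_const.mul (continuous_hPrinted_uncurry par N S ρ₁ J Δ)).pow _

/-- **`A ↦ H_Δ(A)` is a MEASURABLE functional of the configuration** (joint measurability of the integrand + Fubini):
the hypothesis `Measurable (H Δ)` of `…MRS93LargeFieldRegions` §3 / `…MRS93LargeFieldFunctionals` §5 holds for the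
printed `H_Δ`. [cite: MagnenRivasseauSeneor1993, (II.29b) p.337] -/
theorem measurable_Hprinted (M ε₁ : ℝ) (lamT : ℕ → ℝ) (P₁ : ℕ → ℕ) (ρ₁ : ℕ) (J : BoxLabel → Finset (ℕ × ℤ))
    (Δ : BoxLabel) : Measurable (Hprinted par N S M ε₁ lamT P₁ ρ₁ J Δ) := by
  have hf : StronglyMeasurable (Function.uncurry fun (A : Config) (y : Fin 4 → ℝ) =>
      (lamT Δ.1.1 ^ (1 - ε₁ / 64) * M ^ (-(2 * (Δ.1.1 : ℤ))) * hPrinted par N S ρ₁ J A Δ y) ^ P₁ Δ.1.1) :=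
    (continuous_integrandH_uncurry par N S M ε₁ lamT P₁ ρ₁ J Δ).measurable.stronglyMeasurable
  have h : Measurable fun A : Config => ∫ y in Δ.toSet M,
      (lamT Δ.1.1 ^ (1 - ε₁ / 64) * M ^ (-(2 * (Δ.1.1 : ℤ))) * hPrinted par N S ρ₁ J A Δ y) ^ P₁ Δ.1.1 :=
    (hf.integral_prod_right' (ν := volume.restrict (Δ.toSet M))).measurable
  rw [show Hprinted par N S M ε₁ lamT P₁ ρ₁ J Δ = fun A => (volume (Δ.toSet M)).toReal⁻¹ * ∫ y in Δ.toSet M,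
      (lamT Δ.1.1 ^ (1 - ε₁ / 64) * M ^ (-(2 * (Δ.1.1 : ℤ))) * hPrinted par N S ρ₁ J A Δ y) ^ P₁ Δ.1.1 from rfl]
  exact measurable_const.mul h

/-- At fixed `A`, the integrand is continuous in `y`, hence integrable on the (bounded) box.
[cite: MagnenRivasseauSeneor1993, (II.29b) p.337] -/
theorem integrableOn_integrandH (M ε₁ : ℝ) (lamT : ℕ → ℝ) (P₁ : ℕ → ℕ) (ρ₁ : ℕ) (J : BoxLabel → Finset (ℕ × ℤ))
    (Δ : BoxLabel) (A : Config) :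
    IntegrableOn (fun y => (lamT Δ.1.1 ^ (1 - ε₁ / 64) * M ^ (-(2 * (Δ.1.1 : ℤ))) * hPrinted par N S ρ₁ J A Δ y) ^
      P₁ Δ.1.1) (Δ.toSet M) volume := by
  have hc : Continuous fun y =>
      (lamT Δ.1.1 ^ (1 - ε₁ / 64) * M ^ (-(2 * (Δ.1.1 : ℤ))) * hPrinted par N S ρ₁ J A Δ y) ^ P₁ Δ.1.1 := by
    have h := (continuous_integrandH_uncurry par N S M ε₁ lamT P₁ ρ₁ J Δ).comp (Continuous.prodMk_right A)
    exact h
  refine (hc.continuousOn.integrableOn_compact (isCompact_Icc (a := fun μ => (Δ.2 μ : ℝ) *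
    PhaseCells.boxSide M Δ.1.1 Δ.1.2 μ) (b := fun μ => ((Δ.2 μ : ℝ) + 1) * PhaseCells.boxSide M Δ.1.1 Δ.1.2 μ))).mono_set
    fun y hy => ?_
  rw [BoxLabel.toSet, PhaseCells.anisoBox, Set.mem_univ_pi] at hy
  exact ⟨fun μ => (hy μ).1, fun μ => (hy μ).2.le⟩

/-- **`H_Δ(0) = 0`**: the zero configuration has no background gradient, whatever the box, the powers (`P_{1,i} ≥ 1`) and
the admissible pairs. [cite: MagnenRivasseauSeneor1993, (II.29b) p.337] -/
theorem Hprinted_zero_config (M ε₁ : ℝ) (lamT : ℕ → ℝ) {P₁ : ℕ → ℕ} (hP₁ : ∀ i, P₁ i ≠ 0) (ρ₁ : ℕ)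
    (J : BoxLabel → Finset (ℕ × ℤ)) (Δ : BoxLabel) : Hprinted par N S M ε₁ lamT P₁ ρ₁ J Δ 0 = 0 := by
  rw [Hprinted_eq]
  simp_rw [hPrinted_zero_config, mul_zero, zero_pow (hP₁ _), integral_zero, mul_zero]

/-! ## §4a′ `H_Δ` lives on the torus: corners differing by a lattice period give the same functional -/

/-- **`H_Δ` is a functional of the box ON THE TORUS**: two corners that differ by a lattice period (an integer translation
of the box in `ℝ⁴`) give the same `H_Δ(A)` — the background gradient is `ℤ⁴`-periodic and Lebesgue measure is
translation invariant (for admissible-pair data `J` depending on the box only through its lattice `(i, α)`, as the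
printed `r(Δ)`, `k(Δ)` do). [cite: MagnenRivasseauSeneor1993, §II.B (II.29b) p.337, p.335 tl.16–19, §II.A p.328 tl.8] -/
theorem Hprinted_corner_add {M : ℝ} (hM : 0 < M) (ε₁ : ℝ) (lamT : ℕ → ℝ) (P₁ : ℕ → ℕ) (ρ₁ : ℕ)
    {J : BoxLabel → Finset (ℕ × ℤ)} (hJ : ∀ j k k', J (j, k) = J (j, k')) (j : ℕ × ℤ) (k T v : Fin 4 → ℤ)
    (hT : ∀ μ, (T μ : ℝ) * PhaseCells.boxSide M j.1 j.2 μ = v μ) (A : Config) :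
    Hprinted par N S M ε₁ lamT P₁ ρ₁ J (j, k + T) A = Hprinted par N S M ε₁ lamT P₁ ρ₁ J (j, k) A := by
  rw [Hprinted_eq, Hprinted_eq]
  have hvol : (volume (BoxLabel.toSet M (j, k + T))).toReal = (volume (BoxLabel.toSet M (j, k))).toReal := by
    simp only [BoxLabel.toSet]
    rw [PhaseCells.volume_anisoBox hM, PhaseCells.volume_anisoBox hM]
  rw [hvol]
  congr 1
  have hJk : ∀ y, hPrinted par N S ρ₁ J A (j, k + T) y = hPrinted par N S ρ₁ J A (j, k) y := fun y => by
    unfold hPrinted; rw [hJ j (k + T) k]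
  simp_rw [hJk]
  set F : (Fin 4 → ℝ) → ℝ := fun y =>
    (lamT j.1 ^ (1 - ε₁ / 64) * M ^ (-(2 * (j.1 : ℤ))) * hPrinted par N S ρ₁ J A (j, k) y) ^ P₁ j.1 with hF
  set w : Fin 4 → ℝ := fun μ => (v μ : ℝ) with hw
  have hper : ∀ y, F (y + w) = F y := fun y => by
    have e : hPrinted par N S ρ₁ J A (j, k) (y + w) = hPrinted par N S ρ₁ J A (j, k) y := by
      have : y + w = fun μ => y μ + (v μ : ℝ) := by funext μ; rfl
      rw [this, hPrinted_add_intCast]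
    simp only [hF, e]
  have hmeas1 : MeasurableSet (BoxLabel.toSet M (j, k + T)) := PhaseCells.measurableSet_anisoBox M _ _ _
  have hmeas0 : MeasurableSet (BoxLabel.toSet M (j, k)) := PhaseCells.measurableSet_anisoBox M _ _ _
  have hind : ∀ y, (BoxLabel.toSet M (j, k + T)).indicator F (y + w) = (BoxLabel.toSet M (j, k)).indicator F y := by
    intro y
    have hmem : y + w ∈ BoxLabel.toSet M (j, k + T) ↔ y ∈ BoxLabel.toSet M (j, k) := by
      rw [mem_toSet_corner_add_iff M j k T v hT]
      have : (fun μ => (y + w) μ - (v μ : ℝ)) = y := by funext μ; simp [hw]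
      rw [this]
    by_cases hy : y ∈ BoxLabel.toSet M (j, k)
    · rw [Set.indicator_of_mem (hmem.mpr hy), Set.indicator_of_mem hy, hper]
    · rw [Set.indicator_of_notMem (fun h => hy (hmem.mp h)), Set.indicator_of_notMem hy]
  calc ∫ y in BoxLabel.toSet M (j, k + T), F y
      = ∫ y, (BoxLabel.toSet M (j, k + T)).indicator F y := (integral_indicator hmeas1).symm
    _ = ∫ y, (BoxLabel.toSet M (j, k + T)).indicator F (y + w) := (integral_add_right_eq_self _ w).symm
    _ = ∫ y, (BoxLabel.toSet M (j, k)).indicator F y := by simp_rw [hind]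
    _ = ∫ y in BoxLabel.toSet M (j, k), F y := integral_indicator hmeas0

/-! ## §4b `A ↦ H_Δ(A)` is CONTINUOUS (dominated convergence against a finite-mode majorant) -/

/-- A majorant of `∇B` depending on finitely many coordinates of the configuration:
`Σ_{p∈S} Σ_ν Σ_μ Σ_a |ip_ν κ_J(p) Ã^a_μ(p)|`. [cite: MagnenRivasseauSeneor1993, (II.29b) p.337] -/
def gradMajorant (ρ₁ : ℕ) (J : Finset (ℕ × ℤ)) (A : Config) : ℝ :=
  ∑ p ∈ S, ∑ ν : Fin 4, ∑ μ : Fin 4, ∑ a : Fin 3, ‖coeff (derivConfig ν (bgConfig par N ρ₁ J A)) p μ a‖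

/-- The majorant is a continuous function of the configuration. [cite: MagnenRivasseauSeneor1993, (II.29b) p.337] -/
theorem continuous_gradMajorant (ρ₁ : ℕ) (J : Finset (ℕ × ℤ)) : Continuous (gradMajorant par N S ρ₁ J) := by
  unfold gradMajorant
  refine continuous_finsetSum _ fun p _ => continuous_finsetSum _ fun ν _ => continuous_finsetSum _ fun μ _ =>
    continuous_finsetSum _ fun a _ => ?_
  exact continuous_norm.comp ((continuous_coeff p μ a).comp ((continuous_derivConfig ν).comp
    (continuous_bgConfig par N ρ₁ J)))

/-- `0 ≤` the majorant. [cite: MagnenRivasseauSeneor1993, (II.29b) p.337] -/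
theorem gradMajorant_nonneg (ρ₁ : ℕ) (J : Finset (ℕ × ℤ)) (A : Config) : 0 ≤ gradMajorant par N S ρ₁ J A :=
  Finset.sum_nonneg fun _ _ => Finset.sum_nonneg fun _ _ => Finset.sum_nonneg fun _ _ =>
    Finset.sum_nonneg fun _ _ => norm_nonneg _

/-- `|∂_νB^a_μ(Δ, x)| ≤ Σ_p |ip_ν κ_J(p) Ã^a_μ(p)|` (`|e^{ip·x}| = 1`), hence `≤` the majorant, uniformly in `x`.
[cite: MagnenRivasseauSeneor1993, (II.29b) p.337] -/
theorem norm_gradB_le (ρ₁ : ℕ) (J : Finset (ℕ × ℤ)) (A : Config) (ν μ : Fin 4) (a : Fin 3) (x : Pos) :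
    ‖gradB par N S ρ₁ J A ν μ a x‖ ≤ gradMajorant par N S ρ₁ J A := by
  rw [gradB_eq]
  unfold field gradMajorant
  refine (norm_sum_le _ _).trans (Finset.sum_le_sum fun p _ => ?_)
  rw [norm_mul, norm_chi, mul_one]
  refine (Finset.single_le_sum (f := fun ν' => ∑ μ' : Fin 4, ∑ a' : Fin 3,
      ‖coeff (derivConfig ν' (bgConfig par N ρ₁ J A)) p μ' a'‖)
    (fun _ _ => Finset.sum_nonneg fun _ _ => Finset.sum_nonneg fun _ _ => norm_nonneg _) (Finset.mem_univ ν)).trans' ?_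
  refine (Finset.single_le_sum (f := fun μ' => ∑ a' : Fin 3, ‖coeff (derivConfig ν (bgConfig par N ρ₁ J A)) p μ' a'‖)
    (fun _ _ => Finset.sum_nonneg fun _ _ => norm_nonneg _) (Finset.mem_univ μ)).trans' ?_
  exact Finset.single_le_sum (f := fun a' => ‖coeff (derivConfig ν (bgConfig par N ρ₁ J A)) p μ a'‖)
    (fun _ _ => norm_nonneg _) (Finset.mem_univ a)

/-- `|∇B(Δ, x)| ≤ √24 · majorant` (forty-eight components, the factor `1/2`). [cite: MagnenRivasseauSeneor1993, (II.29b) p.337] -/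
theorem gradBNorm_le (ρ₁ : ℕ) (J : Finset (ℕ × ℤ)) (A : Config) (x : Pos) :
    gradBNorm par N S ρ₁ J A x ≤ Real.sqrt 24 * gradMajorant par N S ρ₁ J A := by
  have hm := gradMajorant_nonneg par N S ρ₁ J A
  have hsq : gradBNormSq par N S ρ₁ J A x ≤ 24 * gradMajorant par N S ρ₁ J A ^ 2 := by
    unfold gradBNormSq
    have hterm : ∀ ν μ a, normSq (gradB par N S ρ₁ J A ν μ a x) ≤ gradMajorant par N S ρ₁ J A ^ 2 := fun ν μ a => by
      rw [Complex.normSq_eq_norm_sq]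
      exact pow_le_pow_left₀ (norm_nonneg _) (norm_gradB_le par N S ρ₁ J A ν μ a x) 2
    calc (1 / 2 : ℝ) * ∑ ν, ∑ μ, ∑ a, normSq (gradB par N S ρ₁ J A ν μ a x)
        ≤ (1 / 2) * ∑ _ν : Fin 4, ∑ _μ : Fin 4, ∑ _a : Fin 3, gradMajorant par N S ρ₁ J A ^ 2 := by
          gcongr with ν _ μ _ a _
          exact hterm ν μ a
      _ = 24 * gradMajorant par N S ρ₁ J A ^ 2 := by simp; ring
  unfold gradBNorm
  calc Real.sqrt (gradBNormSq par N S ρ₁ J A x) ≤ Real.sqrt (24 * gradMajorant par N S ρ₁ J A ^ 2) :=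
        Real.sqrt_le_sqrt hsq
    _ = Real.sqrt 24 * gradMajorant par N S ρ₁ J A := by
        rw [Real.sqrt_mul (by norm_num), Real.sqrt_sq hm]

/-- **`A ↦ H_Δ(A)` is a CONTINUOUS functional of the cut-off configuration** (product topology): dominated convergence on
the box, the integrand being bounded near `A₀` through the continuous finite-mode majorant. So the printed `H_Δ` meets
the hypothesis of `LargeFieldRegion.continuous_chiLFR` as well. [cite: MagnenRivasseauSeneor1993, (II.29b) p.337] -/
theorem continuous_Hprinted (M ε₁ : ℝ) (lamT : ℕ → ℝ) (P₁ : ℕ → ℕ) (ρ₁ : ℕ) (J : BoxLabel → Finset (ℕ × ℤ))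
    (Δ : BoxLabel) : Continuous (Hprinted par N S M ε₁ lamT P₁ ρ₁ J Δ) := by
  set c : ℝ := lamT Δ.1.1 ^ (1 - ε₁ / 64) * M ^ (-(2 * (Δ.1.1 : ℤ))) with hc
  rw [show Hprinted par N S M ε₁ lamT P₁ ρ₁ J Δ = fun A => (volume (Δ.toSet M)).toReal⁻¹ * ∫ y in Δ.toSet M,
      (c * hPrinted par N S ρ₁ J A Δ y) ^ P₁ Δ.1.1 from rfl]
  refine continuous_const.mul (continuous_iff_continuousAt.mpr fun A₀ => ?_)
  have hF : Continuous fun Ay : Config × (Fin 4 → ℝ) => (c * hPrinted par N S ρ₁ J Ay.1 Δ Ay.2) ^ P₁ Δ.1.1 :=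
    continuous_integrandH_uncurry par N S M ε₁ lamT P₁ ρ₁ J Δ
  haveI : IsFiniteMeasure (volume.restrict (Δ.toSet M)) := isFiniteMeasure_restrict.mpr (volume_toSet_lt_top M Δ).ne
  have hmaj : ∀ᶠ A in nhds A₀, gradMajorant par N S ρ₁ (J Δ) A < gradMajorant par N S ρ₁ (J Δ) A₀ + 1 :=
    (continuous_gradMajorant par N S ρ₁ (J Δ)).continuousAt.eventually_lt continuousAt_const (by linarith)
  refine continuousAt_of_dominated
    (bound := fun _ => (|c| * (Real.sqrt 24 * (gradMajorant par N S ρ₁ (J Δ) A₀ + 1))) ^ P₁ Δ.1.1)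
    (Filter.Eventually.of_forall fun A => ?_) ?_ (integrable_const _) (ae_of_all _ fun y => ?_)
  · have hA : Continuous fun y : Fin 4 → ℝ => (c * hPrinted par N S ρ₁ J A Δ y) ^ P₁ Δ.1.1 := by
      have h := hF.comp (Continuous.prodMk_right A)
      exact h
    exact hA.aestronglyMeasurable
  · filter_upwards [hmaj] with A hA
    refine ae_of_all _ fun y => ?_
    rw [Real.norm_eq_abs, abs_pow, abs_mul, abs_of_nonneg (hPrinted_nonneg par N S ρ₁ J A Δ y)]
    refine pow_le_pow_left₀ (mul_nonneg (abs_nonneg _) (hPrinted_nonneg par N S ρ₁ J A Δ y))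
      (mul_le_mul_of_nonneg_left ?_ (abs_nonneg _)) _
    exact (gradBNorm_le par N S ρ₁ (J Δ) A (toPos y)).trans
      (mul_le_mul_of_nonneg_left hA.le (Real.sqrt_nonneg _))
  · have hy : Continuous fun A : Config => (c * hPrinted par N S ρ₁ J A Δ y) ^ P₁ Δ.1.1 := by
      have h := hF.comp (Continuous.prodMk_left y)
      exact h
    exact hy.continuousAt

/-! ## §4c Homogeneity: `∇B` is linear and `H_Δ` is homogeneous of degree `P_{1,i}` in the field -/

/-- The Fourier coefficients of `c • A` are `c Ã`. [cite: MagnenRivasseauSeneor1993, §II.A p.328 tl.12–17] -/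
theorem coeff_const_smul (c : ℝ) (A : Config) (p : Momentum) (μ : Fin 4) (a : Fin 3) :
    coeff (c • A) p μ a = (c : ℂ) * coeff A p μ a := by
  unfold coeff
  simp only [Pi.smul_apply, smul_eq_mul]
  push_cast
  ring

/-- **`∇B` is LINEAR in the configuration** (here: homogeneous), `∇B(Δ, x)[cA] = c ∇B(Δ, x)[A]`.
[cite: MagnenRivasseauSeneor1993, (II.29b)–(II.29c) p.337] -/
theorem gradB_smul (ρ₁ : ℕ) (J : Finset (ℕ × ℤ)) (c : ℝ) (A : Config) (ν μ : Fin 4) (a : Fin 3) (x : Pos) :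
    gradB par N S ρ₁ J (c • A) ν μ a x = (c : ℂ) * gradB par N S ρ₁ J A ν μ a x := by
  rw [gradB_eq_sum, gradB_eq_sum, Finset.mul_sum]
  refine Finset.sum_congr rfl fun p _ => ?_
  rw [coeff_const_smul]
  ring

/-- `|∇B(Δ, x)|²[cA] = c² |∇B(Δ, x)|²[A]`. [cite: MagnenRivasseauSeneor1993, (II.29b) p.337] -/
theorem gradBNormSq_smul (ρ₁ : ℕ) (J : Finset (ℕ × ℤ)) (c : ℝ) (A : Config) (x : Pos) :
    gradBNormSq par N S ρ₁ J (c • A) x = c ^ 2 * gradBNormSq par N S ρ₁ J A x := by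
  unfold gradBNormSq
  rw [mul_left_comm (c ^ 2)]
  congr 1
  rw [Finset.mul_sum]
  refine Finset.sum_congr rfl fun ν _ => ?_
  rw [Finset.mul_sum]
  refine Finset.sum_congr rfl fun μ _ => ?_
  rw [Finset.mul_sum]
  refine Finset.sum_congr rfl fun a _ => ?_
  rw [gradB_smul, Complex.normSq_mul, Complex.normSq_ofReal]
  ring

/-- `|∇B(Δ, x)|[cA] = |c| · |∇B(Δ, x)|[A]`. [cite: MagnenRivasseauSeneor1993, (II.29b) p.337] -/
theorem gradBNorm_smul (ρ₁ : ℕ) (J : Finset (ℕ × ℤ)) (c : ℝ) (A : Config) (x : Pos) :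
    gradBNorm par N S ρ₁ J (c • A) x = |c| * gradBNorm par N S ρ₁ J A x := by
  unfold gradBNorm
  rw [gradBNormSq_smul, Real.sqrt_mul (sq_nonneg c), Real.sqrt_sq_eq_abs]

/-- The gradient datum scales by `|c|`. [cite: MagnenRivasseauSeneor1993, (II.29b) p.337] -/
theorem hPrinted_smul (ρ₁ : ℕ) (J : BoxLabel → Finset (ℕ × ℤ)) (c : ℝ) (A : Config) (Δ : BoxLabel) (y : Fin 4 → ℝ) :
    hPrinted par N S ρ₁ J (c • A) Δ y = |c| * hPrinted par N S ρ₁ J A Δ y :=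
  gradBNorm_smul par N S ρ₁ _ c A _

/-- **`H_Δ` IS HOMOGENEOUS OF DEGREE `P_{1,i}` IN THE FIELD**: `H_Δ(cA) = |c|^{P_{1,i}} H_Δ(A)` — the printed functional is the
`P_{1,i}`-th power average of a seminorm of the configuration. [cite: MagnenRivasseauSeneor1993, (II.29b) p.337 tl.15–18] -/
theorem Hprinted_smul (M ε₁ : ℝ) (lamT : ℕ → ℝ) (P₁ : ℕ → ℕ) (ρ₁ : ℕ) (J : BoxLabel → Finset (ℕ × ℤ)) (Δ : BoxLabel)
    (c : ℝ) (A : Config) :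
    Hprinted par N S M ε₁ lamT P₁ ρ₁ J Δ (c • A) = |c| ^ P₁ Δ.1.1 * Hprinted par N S M ε₁ lamT P₁ ρ₁ J Δ A := by
  have h : ∀ y, (lamT Δ.1.1 ^ (1 - ε₁ / 64) * M ^ (-(2 * (Δ.1.1 : ℤ))) * hPrinted par N S ρ₁ J (c • A) Δ y) ^ P₁ Δ.1.1 =
      |c| ^ P₁ Δ.1.1 * (lamT Δ.1.1 ^ (1 - ε₁ / 64) * M ^ (-(2 * (Δ.1.1 : ℤ))) * hPrinted par N S ρ₁ J A Δ y) ^ P₁ Δ.1.1 :=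
    fun y => by rw [hPrinted_smul]; ring
  rw [Hprinted_eq, Hprinted_eq]
  simp_rw [h, integral_const_mul]
  ring

/-! ## §5 The PRINTED index set of (II.29c) and `k(Δ)` of (II.30); the «gap» reading (precision (ab), not adjudicated) -/

/-- **`k(Δ)`** of (II.30) for the box `Δ ∈ 𝐃_{i,α}`: `M^{k(Δ)} = (λ_i^t)^{−ε₁/16}`, i.e. `k(Δ) = −(ε₁/16) ln λ_i^t / ln M`
(`PhaseCells.kIndex` at `λ = λ_i^t`). [cite: MagnenRivasseauSeneor1993, (II.30) p.337 tl.21–22] -/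
def kBox (M ε₁ : ℝ) (lamT : ℕ → ℝ) (Δ : BoxLabel) : ℝ := PhaseCells.kIndex M (lamT Δ.1.1) ε₁

/-- (II.30) AS PRINTED for `kBox`: `M^{k(Δ)} = (λ_i^t)^{−ε₁/16}` (`1 < M`, `0 < λ_i^t`). [cite: MagnenRivasseauSeneor1993, (II.30) p.337] -/
theorem rpow_kBox {M : ℝ} (hM : 1 < M) (ε₁ : ℝ) {lamT : ℕ → ℝ} (Δ : BoxLabel) (hlam : 0 < lamT Δ.1.1) :
    M ^ kBox M ε₁ lamT Δ = lamT Δ.1.1 ^ (-(ε₁ / 16)) :=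
  PhaseCells.rpow_kIndex hM hlam ε₁

/-- `k(Δ) > 0` in the printed regime `0 < λ_i^t < 1 < M`, `ε₁ > 0`. [cite: MagnenRivasseauSeneor1993, (II.30) p.337] -/
theorem kBox_pos {M : ℝ} (hM : 1 < M) {ε₁ : ℝ} (hε₁ : 0 < ε₁) {lamT : ℕ → ℝ} (Δ : BoxLabel)
    (hlam : 0 < lamT Δ.1.1 ∧ lamT Δ.1.1 < 1) : 0 < kBox M ε₁ lamT Δ :=
  kIndex_pos hM hlam.1 hlam.2 hε₁

/-- **AS PRINTED (II.29c)**: the slice pairs `(i′, α′)` of `Jset` whose background field enters `B(Δ, x)`, namely those with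
«r(Δ) > r(Δ′) − k(Δ)» for the boxes `Δ′ ∈ 𝐃_{i′,α′}` (`r(Δ′) = (3i′ + α′)/4` depends on the lattice only).
[cite: MagnenRivasseauSeneor1993, (II.29c) p.337 tl.18–21] -/
def admPrinted (kΔ : ℝ) (Jset : Finset (ℕ × ℤ)) (Δ : BoxLabel) : Finset (ℕ × ℤ) :=
  Jset.filter fun j' => PhaseCells.rIndex j'.1 j'.2 - kΔ < Δ.r

/-- The «gap» reading of p.337 tl.9–10 / tl.32–34 (gen 17's `TestsGap`): tested lattices COARSER than the box by the
margin `k(Δ)`, `r(Δ) > r(Δ′) + k(Δ)`. Typed beside the printed set; which one (II.29c) intends is precision (ab) of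
`…MRS93LargeFieldRegions`, recorded, not adjudicated. [cite: MagnenRivasseauSeneor1993, (II.29c) p.337 with p.337 tl.9–10, tl.32–34] -/
def admGap (kΔ : ℝ) (Jset : Finset (ℕ × ℤ)) (Δ : BoxLabel) : Finset (ℕ × ℤ) :=
  Jset.filter fun j' => PhaseCells.rIndex j'.1 j'.2 + kΔ < Δ.r

/-- Membership in the printed set = gen 17's `TestsPrinted` for (any box of) the tested lattice.
[cite: MagnenRivasseauSeneor1993, (II.29c) p.337] -/
theorem mem_admPrinted_iff_testsPrinted (kΔ : ℝ) (Jset : Finset (ℕ × ℤ)) (Δ : BoxLabel) (j' : ℕ × ℤ)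
    (k' : Fin 4 → ℤ) : j' ∈ admPrinted kΔ Jset Δ ↔ j' ∈ Jset ∧ TestsPrinted kΔ Δ (j', k') := by
  unfold admPrinted TestsPrinted BoxLabel.r
  rw [Finset.mem_filter]

/-- Membership in the gap set = gen 17's `TestsGap`. [cite: MagnenRivasseauSeneor1993, (II.29c) p.337 with p.337 tl.9–10] -/
theorem mem_admGap_iff_testsGap (kΔ : ℝ) (Jset : Finset (ℕ × ℤ)) (Δ : BoxLabel) (j' : ℕ × ℤ) (k' : Fin 4 → ℤ) :
    j' ∈ admGap kΔ Jset Δ ↔ j' ∈ Jset ∧ TestsGap kΔ Δ (j', k') := by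
  unfold admGap TestsGap BoxLabel.r
  rw [Finset.mem_filter]

/-- The gap set is contained in the printed set (`k(Δ) ≥ 0`). [cite: MagnenRivasseauSeneor1993, (II.29c) p.337] -/
theorem admGap_subset_admPrinted {kΔ : ℝ} (hk : 0 ≤ kΔ) (Jset : Finset (ℕ × ℤ)) (Δ : BoxLabel) :
    admGap kΔ Jset Δ ⊆ admPrinted kΔ Jset Δ := by
  intro j' hj'
  rw [admGap, Finset.mem_filter] at hj'
  rw [admPrinted, Finset.mem_filter]
  exact ⟨hj'.1, by linarith [hj'.2]⟩

/-- Both sets are subsets of the index set. [cite: MagnenRivasseauSeneor1993, (II.29c) p.337] -/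
theorem admPrinted_subset (kΔ : ℝ) (Jset : Finset (ℕ × ℤ)) (Δ : BoxLabel) : admPrinted kΔ Jset Δ ⊆ Jset :=
  Finset.filter_subset _ _

/-- Under the printed sign the box's OWN lattice is tested (`k(Δ) > 0`; gen 17's `testsPrinted_self`) …
[cite: MagnenRivasseauSeneor1993, (II.29c) p.337] -/
theorem self_mem_admPrinted {kΔ : ℝ} (hk : 0 < kΔ) {Jset : Finset (ℕ × ℤ)} {Δ : BoxLabel} (hΔ : Δ.1 ∈ Jset) :
    Δ.1 ∈ admPrinted kΔ Jset Δ := by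
  rw [admPrinted, Finset.mem_filter]
  exact ⟨hΔ, by unfold BoxLabel.r; linarith⟩

/-- … whereas under the gap reading it is not (gen 17's `not_testsGap_self`). [cite: MagnenRivasseauSeneor1993, (II.29c) p.337 with p.337 tl.9–10] -/
theorem self_not_mem_admGap {kΔ : ℝ} (hk : 0 ≤ kΔ) (Jset : Finset (ℕ × ℤ)) (Δ : BoxLabel) :
    Δ.1 ∉ admGap kΔ Jset Δ := by
  rw [admGap, Finset.mem_filter]
  rintro ⟨_, h⟩
  unfold BoxLabel.r at h
  linarith

/-- **THE LITERAL (II.29c) IS `Bpos` AT THE PRINTED SET** (restating `Bprinted_apply_eq_Bpos` with `admPrinted`).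
[cite: MagnenRivasseauSeneor1993, (II.29c) p.337 tl.18–21] -/
theorem Bprinted_apply_eq_Bpos_admPrinted {M : ℝ} (hM : 0 < M) (kΔ : ℝ) (ρ₁ : ℕ) (Jset : Finset (ℕ × ℤ))
    (A : Config) (Δ : BoxLabel) (y : Fin 4 → ℝ) (μ : Fin 4) (a : Fin 3) :
    Bprinted M kΔ Jset (fun j' y' => backgroundPos par N S ρ₁ (j'.1, j'.2.toNat) A (toPos y')) Δ y μ a =
      Bpos par N S ρ₁ (admPrinted kΔ Jset Δ) A μ a (toPos y) :=
  Bprinted_apply_eq_Bpos par N S hM kΔ ρ₁ Jset A Δ y μ a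

/-- **THE LITERAL (II.29c), CHARACTERISTIC FUNCTIONS AND ALL, IS DIFFERENTIABLE along every coordinate of `Λ = ℝ⁴/ℤ⁴`**, with
derivative `2π·∇_νB(Δ, x)` at the printed index set (READING (D)): `s ↦ B(Δ, y + s e_ν)` built from gen 17's `Bprinted` (the display
with its `χ_{Δ′}(x)`) has this honest derivative at `s = 0` — the `χ_{Δ′}` sum to `1` lattice by lattice, so no jump survives.
[cite: MagnenRivasseauSeneor1993, (II.29b)–(II.29c) p.337 tl.15–21] -/
theorem hasDerivAt_Bprinted_unitCoords {M : ℝ} (hM : 0 < M) (kΔ : ℝ) (ρ₁ : ℕ) (Jset : Finset (ℕ × ℤ)) (A : Config)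
    (Δ : BoxLabel) (y : Fin 4 → ℝ) (ν μ : Fin 4) (a : Fin 3) :
    HasDerivAt (fun s : ℝ => Bprinted M kΔ Jset (fun j' y' => backgroundPos par N S ρ₁ (j'.1, j'.2.toNat) A (toPos y')) Δ
        (y + Pi.single ν s) μ a)
      ((2 * Real.pi : ℝ) • gradB par N S ρ₁ (admPrinted kΔ Jset Δ) A ν μ a (toPos y)) 0 := by
  have h := hasDerivAt_Bpos_unitCoords par N S ρ₁ (admPrinted kΔ Jset Δ) A ν μ a y
  refine h.congr_of_eventuallyEq (Filter.Eventually.of_forall fun s => ?_)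
  exact Bprinted_apply_eq_Bpos par N S hM kΔ ρ₁ Jset A Δ _ μ a

/-- **The PRINTED admissible-pair datum**: `JPrinted M ε₁ lamT Jset Δ = {(i′, α′) ∈ Jset : r(Δ) > r(i′, α′) − k(Δ)}` with
`k(Δ)` from (II.30). It depends on the box only through its lattice `(i, α)` (`JPrinted_corner`).
[cite: MagnenRivasseauSeneor1993, (II.29c)–(II.30) p.337 tl.18–22] -/
def JPrinted (M ε₁ : ℝ) (lamT : ℕ → ℝ) (Jset : Finset (ℕ × ℤ)) (Δ : BoxLabel) : Finset (ℕ × ℤ) :=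
  admPrinted (kBox M ε₁ lamT Δ) Jset Δ

/-- The gap-reading datum, for comparison. [cite: MagnenRivasseauSeneor1993, (II.29c) p.337 with p.337 tl.9–10] -/
def JGap (M ε₁ : ℝ) (lamT : ℕ → ℝ) (Jset : Finset (ℕ × ℤ)) (Δ : BoxLabel) : Finset (ℕ × ℤ) :=
  admGap (kBox M ε₁ lamT Δ) Jset Δ

/-- `JPrinted` depends on the box only through its lattice. [cite: MagnenRivasseauSeneor1993, (II.29c)–(II.30) p.337] -/
theorem JPrinted_corner (M ε₁ : ℝ) (lamT : ℕ → ℝ) (Jset : Finset (ℕ × ℤ)) (j : ℕ × ℤ) (k k' : Fin 4 → ℤ) :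
    JPrinted M ε₁ lamT Jset (j, k) = JPrinted M ε₁ lamT Jset (j, k') := rfl

/-- `JGap` depends on the box only through its lattice. [cite: MagnenRivasseauSeneor1993, (II.29c)–(II.30) p.337] -/
theorem JGap_corner (M ε₁ : ℝ) (lamT : ℕ → ℝ) (Jset : Finset (ℕ × ℤ)) (j : ℕ × ℤ) (k k' : Fin 4 → ℤ) :
    JGap M ε₁ lamT Jset (j, k) = JGap M ε₁ lamT Jset (j, k') := rfl

/-- `JGap ⊆ JPrinted` in the printed regime (`k(Δ) > 0`). [cite: MagnenRivasseauSeneor1993, (II.29c) p.337] -/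
theorem JGap_subset_JPrinted {M : ℝ} (hM : 1 < M) {ε₁ : ℝ} (hε₁ : 0 < ε₁) {lamT : ℕ → ℝ}
    (hlam : ∀ i, 0 < lamT i ∧ lamT i < 1) (Jset : Finset (ℕ × ℤ)) (Δ : BoxLabel) :
    JGap M ε₁ lamT Jset Δ ⊆ JPrinted M ε₁ lamT Jset Δ :=
  admGap_subset_admPrinted (kBox_pos hM hε₁ Δ (hlam _)).le Jset Δ

/-! ## §6 (II.35) with BOTH printed box functionals `E_Δ` (II.26) and `H_Δ` (II.29b) of the cut-off field -/

/-- **(II.35) p.339 for the tree's `dμ_{0,ρ₁}`·exponential with `E_Δ` = (II.26) AND `H_Δ` = (II.29b) OF THE CUT-OFF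
FIELD** (even powers `P_i`; admissible-pair data `J` of (II.29c) explicit — `JPrinted` for the printed sign):
`∫ e^{(1/2)(…)} dμ_{0,ρ₁} = Σ_LFR ∫ χ_LFR e^{(1/2)(…)} dμ_{0,ρ₁}` in `[0, ∞]`, UNCONDITIONALLY — no measurability binder is
left, both printed functionals being measurable. Both sides may be `+∞` («still formal», p.332 tl.21, inherited).
[cite: MagnenRivasseauSeneor1993, §II.B (II.35) p.339 tl.11–14 with (II.26) p.335, (II.29b) p.337, (II.18) p.332 tl.16–21] -/
theorem lintegral_ymFactor_muZero_eq_sum_LFR_printedEH (lam : ℝ) (ρ₁ : ℕ) (M ε₁ : ℝ) (lamT : ℕ → ℝ) {P : ℕ → ℕ}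
    (hP : ∀ i, Even (P i)) (P₁ : ℕ → ℕ) (J : BoxLabel → Finset (ℕ × ℤ)) (𝓓 : Finset BoxLabel) :
    ∫⁻ A, ENNReal.ofReal (ymFactor S par lam ρ₁ A) ∂(muZero par ρ₁) =
      ∑ D₁ ∈ 𝓓.powerset, ∑ D₂ ∈ 𝓓.powerset,
        ∫⁻ A, ENNReal.ofReal (chiLFR par.τ 𝓓 (Eprinted par N S M ε₁ lamT P)
          (Hprinted par N S M ε₁ lamT P₁ ρ₁ J) D₁ D₂ A * ymFactor S par lam ρ₁ A) ∂(muZero par ρ₁) :=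
  lintegral_ymFactor_muZero_eq_sum_LFR_printedE par N S lam ρ₁ M ε₁ lamT hP 𝓓
    fun Δ _ => measurable_Hprinted par N S M ε₁ lamT P₁ ρ₁ J Δ

/-- The same as Bochner integrals UNDER THE EXPLICIT BINDER that the (II.18) density is `dμ_{0,ρ₁}`-integrable on the
window (not asserted; cf. `…MRS93AxialYMAction` §7, `…MRS93QuarticCountertermDomination`).
[cite: MagnenRivasseauSeneor1993, §II.B (II.35) p.339 tl.11–14; (II.18) p.332 tl.16–21] -/
theorem integral_ymFactor_muZero_eq_sum_LFR_printedEH (lam : ℝ) (ρ₁ : ℕ) (M ε₁ : ℝ) (lamT : ℕ → ℝ) {P : ℕ → ℕ}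
    (hP : ∀ i, Even (P i)) (P₁ : ℕ → ℕ) (J : BoxLabel → Finset (ℕ × ℤ)) (𝓓 : Finset BoxLabel)
    (hint : Integrable (ymFactor S par lam ρ₁) (muZero par ρ₁)) :
    ∫ A, ymFactor S par lam ρ₁ A ∂(muZero par ρ₁) =
      ∑ D₁ ∈ 𝓓.powerset, ∑ D₂ ∈ 𝓓.powerset,
        ∫ A, chiLFR par.τ 𝓓 (Eprinted par N S M ε₁ lamT P) (Hprinted par N S M ε₁ lamT P₁ ρ₁ J) D₁ D₂ A *
          ymFactor S par lam ρ₁ A ∂(muZero par ρ₁) :=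
  integral_ymFactor_muZero_eq_sum_LFR S par lam ρ₁ (fun Δ _ => measurable_Eprinted par N S M ε₁ lamT P Δ)
    (fun Δ _ => measurable_Hprinted par N S M ε₁ lamT P₁ ρ₁ J Δ) (fun Δ _ A => Eprinted_nonneg par N S M ε₁ lamT hP Δ A)
    hint

/-- The weighted form for the OTHER factors of (II.49)/(II.78) multiplying `χ_LFR` (any nonnegative measurable `G`):
`∫ G·(YM factor) dμ_{0,ρ₁} = Σ_LFR ∫ χ_LFR·G·(YM factor) dμ_{0,ρ₁}` in `[0, ∞]`, with the printed `E_Δ`, `H_Δ`.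
[cite: MagnenRivasseauSeneor1993, (II.49) p.342, (II.78) p.347 tl.2–7, (II.35) p.339] -/
theorem lintegral_weight_ymFactor_muZero_eq_sum_LFR_printedEH (lam : ℝ) (ρ₁ : ℕ) (M ε₁ : ℝ) (lamT : ℕ → ℝ)
    {P : ℕ → ℕ} (hP : ∀ i, Even (P i)) (P₁ : ℕ → ℕ) (J : BoxLabel → Finset (ℕ × ℤ)) (𝓓 : Finset BoxLabel)
    {G : Config → ℝ} (hG : Measurable G) (hG0 : ∀ A, 0 ≤ G A) :
    ∫⁻ A, ENNReal.ofReal (G A * ymFactor S par lam ρ₁ A) ∂(muZero par ρ₁) =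
      ∑ D₁ ∈ 𝓓.powerset, ∑ D₂ ∈ 𝓓.powerset,
        ∫⁻ A, ENNReal.ofReal (chiLFR par.τ 𝓓 (Eprinted par N S M ε₁ lamT P)
          (Hprinted par N S M ε₁ lamT P₁ ρ₁ J) D₁ D₂ A * (G A * ymFactor S par lam ρ₁ A)) ∂(muZero par ρ₁) :=
  lintegral_weight_ymFactor_muZero_eq_sum_LFR S par lam ρ₁ (fun Δ _ => measurable_Eprinted par N S M ε₁ lamT P Δ)
    (fun Δ _ => measurable_Hprinted par N S M ε₁ lamT P₁ ρ₁ J Δ) (fun Δ _ A => Eprinted_nonneg par N S M ε₁ lamT hP Δ A)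
    hG hG0

/-- The weights with the printed `E_Δ`, `H_Δ` form a partition of unity on configuration space: `χ_LFR(A) ∈ [0, 1]` and
`Σ_LFR χ_LFR(A) = 1` for every cut-off configuration `A`. [cite: MagnenRivasseauSeneor1993, §II.B (II.35) p.339, (II.26) p.335, (II.29b) p.337] -/
theorem chiLFR_printedEH_mem_Icc (Pτ : CutoffProfile) (M ε₁ : ℝ) (lamT : ℕ → ℝ) {P : ℕ → ℕ} (hP : ∀ i, Even (P i))
    (P₁ : ℕ → ℕ) (ρ₁ : ℕ) (J : BoxLabel → Finset (ℕ × ℤ)) (𝓓 D₁ D₂ : Finset BoxLabel) (A : Config) :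
    chiLFR Pτ 𝓓 (Eprinted par N S M ε₁ lamT P) (Hprinted par N S M ε₁ lamT P₁ ρ₁ J) D₁ D₂ A ∈ Set.Icc (0 : ℝ) 1 ∧
      ∑ D₁' ∈ 𝓓.powerset, ∑ D₂' ∈ 𝓓.powerset,
        chiLFR Pτ 𝓓 (Eprinted par N S M ε₁ lamT P) (Hprinted par N S M ε₁ lamT P₁ ρ₁ J) D₁' D₂' A = 1 :=
  chiLFR_printedE_mem_Icc par N S Pτ M ε₁ lamT hP _ 𝓓 D₁ D₂ A

/-- Each `χ_LFR` with the printed `E_Δ`, `H_Δ` is a CONTINUOUS function of the cut-off configuration.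
[cite: MagnenRivasseauSeneor1993, §II.B p.339 tl.9–10, (II.26) p.335, (II.29b) p.337] -/
theorem continuous_chiLFR_printedEH (Pτ : CutoffProfile) (M ε₁ : ℝ) (lamT : ℕ → ℝ) (P : ℕ → ℕ) (P₁ : ℕ → ℕ)
    (ρ₁ : ℕ) (J : BoxLabel → Finset (ℕ × ℤ)) {𝓓 D₁ D₂ : Finset BoxLabel} (hD₁ : D₁ ⊆ 𝓓) (hD₂ : D₂ ⊆ 𝓓) :
    Continuous (chiLFR Pτ 𝓓 (Eprinted par N S M ε₁ lamT P) (Hprinted par N S M ε₁ lamT P₁ ρ₁ J) D₁ D₂) :=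
  continuous_chiLFR_printedE par N S Pτ M ε₁ lamT P (fun Δ _ => continuous_Hprinted par N S M ε₁ lamT P₁ ρ₁ J Δ)
    hD₁ hD₂

/-- Each `χ_LFR` with the printed `E_Δ`, `H_Δ` is measurable. [cite: MagnenRivasseauSeneor1993, §II.B p.339 tl.9–10] -/
theorem measurable_chiLFR_printedEH (Pτ : CutoffProfile) (M ε₁ : ℝ) (lamT : ℕ → ℝ) (P : ℕ → ℕ) (P₁ : ℕ → ℕ)
    (ρ₁ : ℕ) (J : BoxLabel → Finset (ℕ × ℤ)) {𝓓 D₁ D₂ : Finset BoxLabel} (hD₁ : D₁ ⊆ 𝓓) (hD₂ : D₂ ⊆ 𝓓) :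
    Measurable (chiLFR Pτ 𝓓 (Eprinted par N S M ε₁ lamT P) (Hprinted par N S M ε₁ lamT P₁ ρ₁ J) D₁ D₂) :=
  measurable_chiLFR_printedE par N S Pτ M ε₁ lamT P (fun Δ _ => measurable_Hprinted par N S M ε₁ lamT P₁ ρ₁ J Δ)
    hD₁ hD₂

/-- **AT THE ZERO CONFIGURATION only the outcomes with `𝐃₂ = ∅` carry weight**: `H_Δ(0) = 0 ≤ 1`, so the large-gradient
error term of (II.29a) vanishes in every box (`τ ≡ 1` on `x ≤ 1`; gen 17's `chiLFR_eq_zero_of_H_le_one`) — the printed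
`H_Δ` is not a vacuous datum. [cite: MagnenRivasseauSeneor1993, (II.29a)–(II.29b) p.337, p.330 tl.31–34] -/
theorem chiLFR_printedEH_zero_config (Pτ : CutoffProfile) (M ε₁ : ℝ) (lamT : ℕ → ℝ) (P : ℕ → ℕ) {P₁ : ℕ → ℕ}
    (hP₁ : ∀ i, P₁ i ≠ 0) (ρ₁ : ℕ) (J : BoxLabel → Finset (ℕ × ℤ)) {𝓓 D₁ D₂ : Finset BoxLabel} {Δ : BoxLabel}
    (hΔ : Δ ∈ D₂) :
    chiLFR Pτ 𝓓 (Eprinted par N S M ε₁ lamT P) (Hprinted par N S M ε₁ lamT P₁ ρ₁ J) D₁ D₂ 0 = 0 :=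
  chiLFR_eq_zero_of_H_le_one Pτ D₁ _ hΔ (by rw [Hprinted_zero_config par N S M ε₁ lamT hP₁]; norm_num)

/-! ## §7 Every printed symbol from the pinned carrier's `Parameters` -/

/-- 𝐏 with `ℤ` time labels: the image of `Ansatz.indexFinset N ρ₁` (READING (ι): the boxes of `…MRS93PhaseCells` carry
`α ∈ ℤ`). [cite: MagnenRivasseauSeneor1993, §II.B p.334 tl.44–47] -/
def indexPairs (ρ₁ : ℕ) : Finset (ℕ × ℤ) := (indexFinset N ρ₁).image fun j => (j.1, (j.2 : ℤ))

/-- Membership in `indexPairs`. [cite: MagnenRivasseauSeneor1993, §II.B p.334 tl.44–47] -/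
theorem mem_indexPairs_iff (ρ₁ : ℕ) (i : ℕ) (α : ℤ) :
    (i, α) ∈ indexPairs N ρ₁ ↔ ∃ α' : ℕ, (α' : ℤ) = α ∧ (i, α') ∈ indexFinset N ρ₁ := by
  unfold indexPairs
  rw [Finset.mem_image]
  constructor
  · rintro ⟨⟨i', α'⟩, h, he⟩
    simp only [Prod.mk.injEq] at he
    obtain ⟨rfl, rfl⟩ := he
    exact ⟨α', rfl, h⟩
  · rintro ⟨α', rfl, h⟩
    exact ⟨(i, α'), h, rfl⟩

/-- **(II.29b) with every printed symbol taken from the carrier's `Parameters`**: `M = par.M`, `ε₁ = par.ε₁`,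
`λ_i^t = √(par.tentativeCoupling i)` (gen 17's `lamT`), `κ_{j′}` from `par.τ, par.η, par.M` (inside `bgConfig`), `k(Δ)` by
(II.30), the admissible pairs AS PRINTED (`JPrinted` over 𝐏 = `indexPairs N ρ₁`); the powers `P_{1,i}` (naturals), the
bottom indices `N_i` and the index cutoff `ρ₁` remain the explicit data they are in `…MRS93PhaseCells` /
`…MRS93AnisotropicSlicing`. [cite: MagnenRivasseauSeneor1993, (II.29b)–(II.30) p.337 tl.15–22] -/
def HprintedPar (P₁ : ℕ → ℕ) (ρ₁ : ℕ) (Δ : BoxLabel) (A : Config) : ℝ :=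
  Hprinted par N S (par.M : ℝ) par.ε₁ (lamT par) P₁ ρ₁ (JPrinted (par.M : ℝ) par.ε₁ (lamT par) (indexPairs N ρ₁)) Δ A

/-- The gap-reading twin (precision (ab)), for comparison only. [cite: MagnenRivasseauSeneor1993, (II.29b)–(II.30) p.337 with p.337 tl.9–10] -/
def HprintedParGap (P₁ : ℕ → ℕ) (ρ₁ : ℕ) (Δ : BoxLabel) (A : Config) : ℝ :=
  Hprinted par N S (par.M : ℝ) par.ε₁ (lamT par) P₁ ρ₁ (JGap (par.M : ℝ) par.ε₁ (lamT par) (indexPairs N ρ₁)) Δ A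

/-- `H_Δ ≥ 0` for the carrier's parameters, for EVERY power (`M ≥ 2 > 0`, `λ_i^t = √· ≥ 0`).
[cite: MagnenRivasseauSeneor1993, (II.29b) p.337] -/
theorem HprintedPar_nonneg (P₁ : ℕ → ℕ) (ρ₁ : ℕ) (Δ : BoxLabel) (A : Config) : 0 ≤ HprintedPar par N S P₁ ρ₁ Δ A :=
  Hprinted_nonneg' par N S (by exact_mod_cast (Nat.zero_le par.M)) par.ε₁ (lamT_nonneg par) P₁ ρ₁ _ Δ A

/-- `A ↦ H_Δ(A)` continuous, carrier's parameters. [cite: MagnenRivasseauSeneor1993, (II.29b) p.337] -/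
theorem continuous_HprintedPar (P₁ : ℕ → ℕ) (ρ₁ : ℕ) (Δ : BoxLabel) : Continuous (HprintedPar par N S P₁ ρ₁ Δ) :=
  continuous_Hprinted par N S _ _ _ P₁ ρ₁ _ Δ

/-- `A ↦ H_Δ(A)` measurable, carrier's parameters. [cite: MagnenRivasseauSeneor1993, (II.29b) p.337] -/
theorem measurable_HprintedPar (P₁ : ℕ → ℕ) (ρ₁ : ℕ) (Δ : BoxLabel) : Measurable (HprintedPar par N S P₁ ρ₁ Δ) :=
  measurable_Hprinted par N S _ _ _ P₁ ρ₁ _ Δ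

/-- `H_Δ` for the carrier's parameters is a functional of the box ON THE TORUS (`M = par.M ≥ 2 > 0`; `JPrinted` depends on
the lattice only). [cite: MagnenRivasseauSeneor1993, (II.29b) p.337, p.335 tl.16–19] -/
theorem HprintedPar_corner_add (P₁ : ℕ → ℕ) (ρ₁ : ℕ) (j : ℕ × ℤ) (k T v : Fin 4 → ℤ)
    (hT : ∀ μ, (T μ : ℝ) * PhaseCells.boxSide (par.M : ℝ) j.1 j.2 μ = v μ) (A : Config) :
    HprintedPar par N S P₁ ρ₁ (j, k + T) A = HprintedPar par N S P₁ ρ₁ (j, k) A := by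
  have hM : (0 : ℝ) < (par.M : ℝ) := by
    have := par.hM
    exact_mod_cast (by omega : 0 < par.M)
  exact Hprinted_corner_add par N S hM par.ε₁ (lamT par) P₁ ρ₁ (fun j k k' => rfl) j k T v hT A

/-- `H_Δ(0) = 0` for the carrier's parameters (`P_{1,i} ≥ 1`). [cite: MagnenRivasseauSeneor1993, (II.29b) p.337] -/
theorem HprintedPar_zero_config {P₁ : ℕ → ℕ} (hP₁ : ∀ i, P₁ i ≠ 0) (ρ₁ : ℕ) (Δ : BoxLabel) :
    HprintedPar par N S P₁ ρ₁ Δ 0 = 0 :=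
  Hprinted_zero_config par N S _ _ _ hP₁ ρ₁ _ Δ

/-- At the zero configuration only the outcomes with `𝐃₂ = ∅` weigh, carrier's parameters.
[cite: MagnenRivasseauSeneor1993, (II.29a)–(II.29b) p.337] -/
theorem chiLFR_parEH_zero_config (P : ℕ → ℕ) {P₁ : ℕ → ℕ} (hP₁ : ∀ i, P₁ i ≠ 0) (ρ₁ : ℕ)
    {𝓓 D₁ D₂ : Finset BoxLabel} {Δ : BoxLabel} (hΔ : Δ ∈ D₂) :
    chiLFR par.τ 𝓓 (EprintedPar par N S P) (HprintedPar par N S P₁ ρ₁) D₁ D₂ 0 = 0 :=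
  chiLFR_eq_zero_of_H_le_one par.τ D₁ _ hΔ (by rw [HprintedPar_zero_config par N S hP₁]; norm_num)

/-- **(II.35) for the pinned carrier's own data**: `dμ_{0,ρ₁}` = `muZero par ρ₁`, the exponential = `ymFactor S par lam ρ₁`,
`τ = par.τ`, `E_Δ` = (II.26) and `H_Δ` = (II.29b) of the cut-off field with `M, ε₁, λ_i^t, κ_{j′}, k(Δ)` from `par` and the
admissible pairs AS PRINTED (any powers `P_i`, `P_{1,i}`): `∫ e^{(1/2)(…)} dμ_{0,ρ₁} = Σ_LFR ∫ χ_LFR e^{(1/2)(…)} dμ_{0,ρ₁}`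
in `[0, ∞]`, unconditionally. [cite: MagnenRivasseauSeneor1993, §II.B (II.35) p.339 tl.11–14 with (II.26) p.335, (II.29b) p.337, (II.18) p.332 tl.16–21] -/
theorem lintegral_ymFactor_muZero_eq_sum_LFR_parEH (lam : ℝ) (ρ₁ : ℕ) (P P₁ : ℕ → ℕ) (𝓓 : Finset BoxLabel) :
    ∫⁻ A, ENNReal.ofReal (ymFactor S par lam ρ₁ A) ∂(muZero par ρ₁) =
      ∑ D₁ ∈ 𝓓.powerset, ∑ D₂ ∈ 𝓓.powerset,
        ∫⁻ A, ENNReal.ofReal (chiLFR par.τ 𝓓 (EprintedPar par N S P) (HprintedPar par N S P₁ ρ₁) D₁ D₂ A *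
          ymFactor S par lam ρ₁ A) ∂(muZero par ρ₁) :=
  lintegral_ymFactor_muZero_eq_sum_LFR_par par N S lam ρ₁ P 𝓓 fun Δ _ => measurable_HprintedPar par N S P₁ ρ₁ Δ

/-- The weights for the carrier's data: `χ_LFR(A) ∈ [0, 1]`, `Σ_LFR χ_LFR(A) = 1`, every cut-off `A` (any powers).
[cite: MagnenRivasseauSeneor1993, §II.B (II.35) p.339] -/
theorem chiLFR_parEH_mem_Icc (P P₁ : ℕ → ℕ) (ρ₁ : ℕ) (𝓓 D₁ D₂ : Finset BoxLabel) (A : Config) :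
    chiLFR par.τ 𝓓 (EprintedPar par N S P) (HprintedPar par N S P₁ ρ₁) D₁ D₂ A ∈ Set.Icc (0 : ℝ) 1 ∧
      ∑ D₁' ∈ 𝓓.powerset, ∑ D₂' ∈ 𝓓.powerset,
        chiLFR par.τ 𝓓 (EprintedPar par N S P) (HprintedPar par N S P₁ ρ₁) D₁' D₂' A = 1 :=
  ⟨⟨chiLFR_nonneg par.τ D₂ _ fun Δ _ => EprintedPar_nonneg par N S P Δ A,
    chiLFR_le_one par.τ D₂ _ (fun Δ _ => EprintedPar_nonneg par N S P Δ A)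
      fun Δ _ => EprintedPar_nonneg par N S P Δ A⟩,
    sum_sum_chiLFR_eq_one par.τ 𝓓 _ _ A⟩

end LargeFieldRegion

end Literature.MathematicalPhysics.QuantumFieldTheory.MagnenRivasseauSeneor1993
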